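import Mathlib.Analysis.SpecialFunctions.Complex.Arg
import Literature.Geometry.DiscreteGeometry.SphericalExcessMonotone
import Literature.Geometry.DiscreteGeometry.SphericalPolygonArea
import Literature.Geometry.DiscreteGeometry.KissingAngleBounds
import Literature.Geometry.DiscreteGeometry.LayerShells
import HarnessLib

/-!
# The angle budget of a tolerant hexagonal-antiprism shell on the sphere of directions

Topic `Literature/Geometry/DiscreteGeometry`.  Elementary spherical geometry behind the
exclusion of the hexagonal antiprism from the census of "gapped twelve-shells" (twelve unit
spheres around a central one with `2 %` tolerance, every sphere touching exactly four others):
if the normalised directions `A₀ … A₅`, `B₀ … B₅` of such a shell had the bond graph of the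
hexagonal antiprism (rings `A`, `B`; `Bᵢ` bonded to `Aᵢ`, `Aᵢ₊₁`; bond cosines in
`[c₁, c₀] = [2201/4802, 2801/5202]`, ring diagonals `Xᵢ Xᵢ₊₂` of cosine `≤ 1233/5202`) and all
`36` corners of the twelve band triangles in `[arccos (81/200), arccos (1/4)]`, the area of the
sphere would be exceeded: **`no_config`**.  The proof is Gauss–Bonnet bookkeeping done entirely
with ANGLES (no measure theory):

* Part 1 — **turns as complex numbers.**  About a unit vector `v`, the turn from `x` to `y` is
  `pdot + i det` with `pdot = ⟪x, y⟫ − ⟪v, x⟫⟪v, y⟫ = ⟪perpTo v x, perpTo v y⟫` and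
  `det = orient3 v x y`; `Z(x,y) Z(y,z) = ‖perpTo v y‖² Z(x,z)` (`turnZ_mul`, a polynomial
  identity), `|arg Z| = ∠(perpTo v x, perpTo v y)` with the sign of `det`, hence around a closed
  chain of directions the signed angles add up to `2πn` (`turnZ_cycle4`, `turnZ_cycle6`) — the
  planar "angles around a point" without choosing a frame.
* Part 2 — **the angles around a shell vertex**: four bonded directions with corners in
  `[Tm, TM]`, `π/3 < Tm ≤ TM < π/2`, and a large closing angle have one common orientation and
  closing angle `2π − T₁ − T₂ − T₃` (`vertex4`); six directions at an odd ring vertex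
  (`vertex6`).
* Part 3 — cosine windows of bonds / far pairs for the normalised points; the **ear estimate**
  `ear_excess` (a triangle with legs in `[c₁, c₀]` has excess at least that of the isosceles
  triangle with legs `c₀` and the same apex angle — Euler's formula `1 − cos E = F` of
  `SphericalExcessEuler`, here `tan (E/2) = P sin C/(1 + P cos C)` is increasing in
  `P = tan (s/2) tan (s'/2)`); the **inner triangle** `inner_angle_bound` (spherical law of
  cosines).
* Part 4 — certified constants (`cos`/`arccos` brackets from `KissingAngleBounds`).
* Part 5 — **the ring budget** `ring_budget` (eighteen corners of a ring `≤ 9π − 3371/500`: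
  three ears + the inscribed triangle, two boxes per apex cosine) and `no_config` (the twelve
  band triangles have excess `≥ 249/500` each by the corner principle
  `le_eulerF_of_corners₃`; `12π + 12 · 0.498 ≤ 18π − 2 · 6.742` is false).

Everything is PROVED; no definitions (local notations only), no named facts.  The consumer is
`Summits/AtomisticToContinuum/Crystallization/Theorems/…StubNoAntiprism.lean`, which feeds in the
coupled corner bounds of the original (non-normalised) points.

## References
* L. Euler, *De mensura angulorum solidorum*, Acta Acad. Petrop. 2 (1781) 31–54; I. Todhunter,
  J. G. Leathem, *Spherical Trigonometry* (1914), Arts. 47, 102–103 (law of cosines, the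
  excess in terms of two sides and the included angle). [folklore]
* A. Van Oosterom, J. Strackee, IEEE Trans. Biomed. Eng. 30 (1983) 125–126 (the solid angle
  of a plane triangle, `tan (Ω/2)`). [folklore]
* T. C. Hales, arXiv:1209.6043 (2012), proof of Lemma 9 (angles around a node sum to `2π`;
  area bookkeeping on the contact fan). [`Hales2012`]
-/

noncomputable section

namespace Literature.Geometry.DiscreteGeometry

namespace AntiprismShell

open scoped RealInnerProductSpace
open InnerProductGeometry Real

local notation "E3" => EuclideanSpace ℝ (Fin 3)

/-! ### Part 1. Planar turns about a unit vector as complex numbers -/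

/-- The planar dot product of `x, y` seen from `v`: `⟪x, y⟫ − ⟪v, x⟫⟪v, y⟫`
(`= ⟪perpTo v x, perpTo v y⟫` for a unit vector `v`). -/
local notation "pdot[" v "](" x ", " y ")" => (⟪x, y⟫ - ⟪v, x⟫ * ⟪v, y⟫ : ℝ)

/-- The turn from `x` to `y` about `v` as the complex number `pdot + i · det[v; x; y]`. -/
local notation "turnZ[" v "](" x ", " y ")" =>
  (Complex.mk (⟪x, y⟫ - ⟪v, x⟫ * ⟪v, y⟫) (orient3 v x y))

/-- A unit vector has `⟪v, v⟫ = 1`. [folklore] -/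
private theorem inner_self_of_unit {v : E3} (hv : ‖v‖ = 1) : ⟪v, v⟫ = 1 := by
  rw [real_inner_self_eq_norm_sq, hv, one_pow]

/-- `pdot` is the inner product of the projections. [folklore] -/
private theorem pdot_eq_inner {v : E3} (hv : ‖v‖ = 1) (x y : E3) :
    pdot[v](x, y) = ⟪perpTo v x, perpTo v y⟫ := by
  rw [inner_perpTo_perpTo_of_norm_eq_one hv]

/-- `pdot[v](x, x) = ‖perpTo v x‖²`. [folklore] -/
private theorem pdot_self {v : E3} (hv : ‖v‖ = 1) (x : E3) : pdot[v](x, x) = ‖perpTo v x‖ ^ 2 := by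
  rw [pdot_eq_inner hv, real_inner_self_eq_norm_sq]

/-- **Multiplicativity of turns**: `Z(x,y) · Z(y,z) = ‖p y‖² · Z(x,z)` (the complex numbers
`conj ζ_x ζ_y` of a planar frame). [folklore] -/
private theorem turnZ_mul {v : E3} (hv : ‖v‖ = 1) (x y z : E3) :
    turnZ[v](x, y) * turnZ[v](y, z) = (pdot[v](y, y) : ℂ) * turnZ[v](x, z) := by
  have h1 := inner_self_of_unit hv
  have hre : (⟪v, v⟫ * ⟪x, y⟫ - ⟪v, x⟫ * ⟪v, y⟫) * (⟪v, v⟫ * ⟪y, z⟫ - ⟪v, y⟫ * ⟪v, z⟫)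
      - ⟪v, v⟫ * (orient3 v x y * orient3 v y z)
      = (⟪v, v⟫ * ⟪y, y⟫ - ⟪v, y⟫ * ⟪v, y⟫) * (⟪v, v⟫ * ⟪x, z⟫ - ⟪v, x⟫ * ⟪v, z⟫) := by
    simp only [inner_fin3, orient3]; ring
  have him : (⟪v, v⟫ * ⟪x, y⟫ - ⟪v, x⟫ * ⟪v, y⟫) * orient3 v y z
      + orient3 v x y * (⟪v, v⟫ * ⟪y, z⟫ - ⟪v, y⟫ * ⟪v, z⟫)
      = (⟪v, v⟫ * ⟪y, y⟫ - ⟪v, y⟫ * ⟪v, y⟫) * orient3 v x z := by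
    simp only [inner_fin3, orient3]; ring
  rw [h1] at hre him
  simp only [one_mul] at hre him
  apply Complex.ext
  · simp only [Complex.mul_re, Complex.ofReal_re, Complex.ofReal_im, zero_mul,
      sub_zero]
    linarith [hre]
  · simp only [Complex.mul_im, Complex.ofReal_re, Complex.ofReal_im, zero_mul,
      add_zero]
    linarith [him]

/-- **Lagrange's identity** for the planar parts: `pdot(x,x) pdot(y,y) − pdot(x,y)² = det²`. [folklore] -/
private theorem pdot_lagrange {v : E3} (hv : ‖v‖ = 1) (x y : E3) :
    pdot[v](x, x) * pdot[v](y, y) - pdot[v](x, y) ^ 2 = orient3 v x y ^ 2 := by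
  have h1 := inner_self_of_unit hv
  have key : (⟪v, v⟫ * ⟪x, x⟫ - ⟪v, x⟫ * ⟪v, x⟫) * (⟪v, v⟫ * ⟪y, y⟫ - ⟪v, y⟫ * ⟪v, y⟫)
      - (⟪v, v⟫ * ⟪x, y⟫ - ⟪v, x⟫ * ⟪v, y⟫) ^ 2 = ⟪v, v⟫ * orient3 v x y ^ 2 := by
    simp only [inner_fin3, orient3]; ring
  rw [h1] at key
  simp only [one_mul] at key
  simpa using key

/-- The modulus of a turn is the product of the two projection lengths. [folklore] -/
private theorem norm_turnZ {v : E3} (hv : ‖v‖ = 1) (x y : E3) :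
    ‖turnZ[v](x, y)‖ = ‖perpTo v x‖ * ‖perpTo v y‖ := by
  have hsq : ‖turnZ[v](x, y)‖ ^ 2 = (‖perpTo v x‖ * ‖perpTo v y‖) ^ 2 := by
    rw [Complex.sq_norm, Complex.normSq_mk, mul_pow, ← pdot_self hv, ← pdot_self hv]
    have := pdot_lagrange hv x y
    nlinarith [this]
  exact (sq_eq_sq₀ (norm_nonneg _) (by positivity)).1 hsq

/-- A turn between directions with nonzero projections is a nonzero complex number. [folklore] -/
private theorem turnZ_ne_zero {v : E3} (hv : ‖v‖ = 1) {x y : E3} (hx : perpTo v x ≠ 0)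
    (hy : perpTo v y ≠ 0) : turnZ[v](x, y) ≠ 0 := by
  rw [← norm_pos_iff, norm_turnZ hv]
  exact mul_pos (norm_pos_iff.2 hx) (norm_pos_iff.2 hy)

/-- **The argument of a turn is `±` the angle between the projections.** [folklore] -/
private theorem abs_arg_turnZ {v : E3} (hv : ‖v‖ = 1) {x y : E3} (hx : perpTo v x ≠ 0)
    (hy : perpTo v y ≠ 0) :
    |(turnZ[v](x, y)).arg| = angle (perpTo v x) (perpTo v y) := by
  have hz := turnZ_ne_zero hv hx hy
  rw [← Real.arccos_cos (abs_nonneg _) (Complex.abs_arg_le_pi _), Real.cos_abs,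
    Complex.cos_arg hz, norm_turnZ hv, angle, ← pdot_eq_inner hv]

/-- A positively oriented turn has argument `+angle`. [folklore] -/
private theorem arg_turnZ_of_pos {v : E3} (hv : ‖v‖ = 1) {x y : E3} (hx : perpTo v x ≠ 0)
    (hy : perpTo v y ≠ 0) (h : 0 < orient3 v x y) :
    (turnZ[v](x, y)).arg = angle (perpTo v x) (perpTo v y) := by
  rw [← abs_arg_turnZ hv hx hy, abs_of_nonneg]
  exact Complex.arg_nonneg_iff.2 h.le

/-- A negatively oriented turn has argument `−angle`. [folklore] -/
private theorem arg_turnZ_of_neg {v : E3} (hv : ‖v‖ = 1) {x y : E3} (hx : perpTo v x ≠ 0)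
    (hy : perpTo v y ≠ 0) (h : orient3 v x y < 0) :
    (turnZ[v](x, y)).arg = -angle (perpTo v x) (perpTo v y) := by
  rw [← abs_arg_turnZ hv hx hy, abs_of_neg, neg_neg]
  exact Complex.arg_neg_iff.2 h

/-- In general the argument is `±angle`. [folklore] -/
private theorem arg_turnZ_eq_or {v : E3} (hv : ‖v‖ = 1) {x y : E3} (hx : perpTo v x ≠ 0)
    (hy : perpTo v y ≠ 0) :
    (turnZ[v](x, y)).arg = angle (perpTo v x) (perpTo v y) ∨
      (turnZ[v](x, y)).arg = -angle (perpTo v x) (perpTo v y) :=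
  (abs_eq (angle_nonneg _ _)).1 (abs_arg_turnZ hv hx hy)

/-- The turn from a direction to itself is the positive real `‖p x‖²`. [folklore] -/
private theorem turnZ_self {v : E3} (x : E3) : turnZ[v](x, x) = (pdot[v](x, x) : ℂ) := by
  apply Complex.ext
  · simp only [Complex.ofReal_re]
  · simp only [Complex.ofReal_im, orient3_self_right]

/-- **Winding of four turns**: about a unit vector `v`, the arguments of the turns
`x₁ → x₂ → x₃ → x₄ → x₁` add up to a multiple of `2π`. [folklore] -/
private theorem turnZ_cycle4 {v : E3} (hv : ‖v‖ = 1) {x₁ x₂ x₃ x₄ : E3} (h₁ : perpTo v x₁ ≠ 0)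
    (h₂ : perpTo v x₂ ≠ 0) (h₃ : perpTo v x₃ ≠ 0) (h₄ : perpTo v x₄ ≠ 0) :
    ∃ n : ℤ, (turnZ[v](x₁, x₂)).arg + (turnZ[v](x₂, x₃)).arg + (turnZ[v](x₃, x₄)).arg +
      (turnZ[v](x₄, x₁)).arg = n * (2 * π) := by
  have hρ : ∀ {x : E3}, perpTo v x ≠ 0 → 0 < pdot[v](x, x) := fun hx => by
    rw [pdot_self hv]; exact pow_pos (norm_pos_iff.2 hx) 2
  have z12 := turnZ_ne_zero hv h₁ h₂
  have z23 := turnZ_ne_zero hv h₂ h₃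
  have z34 := turnZ_ne_zero hv h₃ h₄
  have z41 := turnZ_ne_zero hv h₄ h₁
  have hprod : turnZ[v](x₁, x₂) * turnZ[v](x₂, x₃) * turnZ[v](x₃, x₄) * turnZ[v](x₄, x₁) =
      ((pdot[v](x₂, x₂) * pdot[v](x₃, x₃) * pdot[v](x₄, x₄) * pdot[v](x₁, x₁) : ℝ) : ℂ) := by
    calc turnZ[v](x₁, x₂) * turnZ[v](x₂, x₃) * turnZ[v](x₃, x₄) * turnZ[v](x₄, x₁)
        = (pdot[v](x₂, x₂) : ℂ) * (turnZ[v](x₁, x₃) * turnZ[v](x₃, x₄)) * turnZ[v](x₄, x₁) := by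
          rw [turnZ_mul hv]; ring
      _ = (pdot[v](x₂, x₂) : ℂ) * (pdot[v](x₃, x₃) : ℂ) * (turnZ[v](x₁, x₄) * turnZ[v](x₄, x₁)) := by
          rw [turnZ_mul hv]; ring
      _ = _ := by rw [turnZ_mul hv, turnZ_self]; push_cast; ring
  have hpos : 0 < pdot[v](x₂, x₂) * pdot[v](x₃, x₃) * pdot[v](x₄, x₄) * pdot[v](x₁, x₁) :=
    mul_pos (mul_pos (mul_pos (hρ h₂) (hρ h₃)) (hρ h₄)) (hρ h₁)
  have harg : ((turnZ[v](x₁, x₂) * turnZ[v](x₂, x₃) * turnZ[v](x₃, x₄) * turnZ[v](x₄, x₁)).arg :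
      Real.Angle) = 0 := by
    rw [hprod, Complex.arg_ofReal_of_nonneg hpos.le, Real.Angle.coe_zero]
  rw [Complex.arg_mul_coe_angle (mul_ne_zero (mul_ne_zero z12 z23) z34) z41,
    Complex.arg_mul_coe_angle (mul_ne_zero z12 z23) z34, Complex.arg_mul_coe_angle z12 z23,
    ← Real.Angle.coe_add, ← Real.Angle.coe_add, ← Real.Angle.coe_add,
    Real.Angle.coe_eq_zero_iff] at harg
  obtain ⟨n, hn⟩ := harg
  exact ⟨n, by rw [← hn, zsmul_eq_mul]⟩

/-- **Winding of six turns.** [folklore] -/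
private theorem turnZ_cycle6 {v : E3} (hv : ‖v‖ = 1) {x₁ x₂ x₃ x₄ x₅ x₆ : E3}
    (h₁ : perpTo v x₁ ≠ 0) (h₂ : perpTo v x₂ ≠ 0) (h₃ : perpTo v x₃ ≠ 0) (h₄ : perpTo v x₄ ≠ 0)
    (h₅ : perpTo v x₅ ≠ 0) (h₆ : perpTo v x₆ ≠ 0) :
    ∃ n : ℤ, (turnZ[v](x₁, x₂)).arg + (turnZ[v](x₂, x₃)).arg + (turnZ[v](x₃, x₄)).arg +
      (turnZ[v](x₄, x₅)).arg + (turnZ[v](x₅, x₆)).arg + (turnZ[v](x₆, x₁)).arg = n * (2 * π) := by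
  have hρ : ∀ {x : E3}, perpTo v x ≠ 0 → 0 < pdot[v](x, x) := fun hx => by
    rw [pdot_self hv]; exact pow_pos (norm_pos_iff.2 hx) 2
  have z12 := turnZ_ne_zero hv h₁ h₂
  have z23 := turnZ_ne_zero hv h₂ h₃
  have z34 := turnZ_ne_zero hv h₃ h₄
  have z45 := turnZ_ne_zero hv h₄ h₅
  have z56 := turnZ_ne_zero hv h₅ h₆
  have z61 := turnZ_ne_zero hv h₆ h₁
  have hprod : turnZ[v](x₁, x₂) * turnZ[v](x₂, x₃) * turnZ[v](x₃, x₄) * turnZ[v](x₄, x₅) * turnZ[v](x₅, x₆) *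
      turnZ[v](x₆, x₁) = ((pdot[v](x₂, x₂) * pdot[v](x₃, x₃) * pdot[v](x₄, x₄) * pdot[v](x₅, x₅) *
        pdot[v](x₆, x₆) * pdot[v](x₁, x₁) : ℝ) : ℂ) := by
    calc turnZ[v](x₁, x₂) * turnZ[v](x₂, x₃) * turnZ[v](x₃, x₄) * turnZ[v](x₄, x₅) * turnZ[v](x₅, x₆) * turnZ[v](x₆, x₁)
        = (pdot[v](x₂, x₂) : ℂ) * (turnZ[v](x₁, x₃) * turnZ[v](x₃, x₄)) * turnZ[v](x₄, x₅) * turnZ[v](x₅, x₆) *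
            turnZ[v](x₆, x₁) := by
          rw [turnZ_mul hv]; ring
      _ = (pdot[v](x₂, x₂) : ℂ) * (pdot[v](x₃, x₃) : ℂ) * (turnZ[v](x₁, x₄) * turnZ[v](x₄, x₅)) *
            turnZ[v](x₅, x₆) * turnZ[v](x₆, x₁) := by
          rw [turnZ_mul hv]; ring
      _ = (pdot[v](x₂, x₂) : ℂ) * (pdot[v](x₃, x₃) : ℂ) * (pdot[v](x₄, x₄) : ℂ) *
            (turnZ[v](x₁, x₅) * turnZ[v](x₅, x₆)) * turnZ[v](x₆, x₁) := by
          rw [turnZ_mul hv]; ring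
      _ = (pdot[v](x₂, x₂) : ℂ) * (pdot[v](x₃, x₃) : ℂ) * (pdot[v](x₄, x₄) : ℂ) * (pdot[v](x₅, x₅) : ℂ) *
            (turnZ[v](x₁, x₆) * turnZ[v](x₆, x₁)) := by
          rw [turnZ_mul hv]; ring
      _ = _ := by rw [turnZ_mul hv, turnZ_self]; push_cast; ring
  have hpos : 0 < pdot[v](x₂, x₂) * pdot[v](x₃, x₃) * pdot[v](x₄, x₄) * pdot[v](x₅, x₅) * pdot[v](x₆, x₆) *
      pdot[v](x₁, x₁) :=
    mul_pos (mul_pos (mul_pos (mul_pos (mul_pos (hρ h₂) (hρ h₃)) (hρ h₄)) (hρ h₅)) (hρ h₆))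
      (hρ h₁)
  have harg : ((turnZ[v](x₁, x₂) * turnZ[v](x₂, x₃) * turnZ[v](x₃, x₄) * turnZ[v](x₄, x₅) * turnZ[v](x₅, x₆) *
      turnZ[v](x₆, x₁)).arg : Real.Angle) = 0 := by
    rw [hprod, Complex.arg_ofReal_of_nonneg hpos.le, Real.Angle.coe_zero]
  rw [Complex.arg_mul_coe_angle
      (mul_ne_zero (mul_ne_zero (mul_ne_zero (mul_ne_zero z12 z23) z34) z45) z56) z61,
    Complex.arg_mul_coe_angle (mul_ne_zero (mul_ne_zero (mul_ne_zero z12 z23) z34) z45) z56,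
    Complex.arg_mul_coe_angle (mul_ne_zero (mul_ne_zero z12 z23) z34) z45,
    Complex.arg_mul_coe_angle (mul_ne_zero z12 z23) z34, Complex.arg_mul_coe_angle z12 z23,
    ← Real.Angle.coe_add, ← Real.Angle.coe_add, ← Real.Angle.coe_add, ← Real.Angle.coe_add,
    ← Real.Angle.coe_add, Real.Angle.coe_eq_zero_iff] at harg
  obtain ⟨n, hn⟩ := harg
  exact ⟨n, by rw [← hn, zsmul_eq_mul]⟩


/-! ### Part 2. The angles around a shell vertex -/

/-- An integer `n` with `lo < 2πn < hi`, `−2π ≤ lo`, `hi ≤ 2π`, is `0`. [folklore] -/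
private theorem int_eq_zero_of_two_pi {n : ℤ} {x : ℝ} (h : x = n * (2 * π)) (h1 : -(2 * π) < x)
    (h2 : x < 2 * π) : n = 0 := by
  have hπ := Real.pi_pos
  have h3 : (-1 : ℝ) < n := by
    by_contra h'
    have : (n : ℝ) ≤ -1 := le_of_not_gt h'
    nlinarith
  have h4 : (n : ℝ) < 1 := by
    by_contra h'
    have : (1 : ℝ) ≤ n := le_of_not_gt h'
    nlinarith
  have h3' : (-1 : ℤ) < n := by exact_mod_cast h3
  have h4' : n < (1 : ℤ) := by exact_mod_cast h4
  omega

/-- An integer `n` with `0 < 2πn < 4π` is `1`. [folklore] -/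
private theorem int_eq_one_of_two_pi {n : ℤ} {x : ℝ} (h : x = n * (2 * π)) (h1 : 0 < x)
    (h2 : x < 4 * π) : n = 1 := by
  have hπ := Real.pi_pos
  have h3 : (0 : ℝ) < n := by
    by_contra h'
    have : (n : ℝ) ≤ 0 := le_of_not_gt h'
    nlinarith
  have h4 : (n : ℝ) < 2 := by
    by_contra h'
    have : (2 : ℝ) ≤ n := le_of_not_gt h'
    nlinarith
  have h3' : (0 : ℤ) < n := by exact_mod_cast h3
  have h4' : n < (2 : ℤ) := by exact_mod_cast h4
  omega

/-- There is no integer `n` with `0 < 2πn < 2π`. [folklore] -/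
private theorem no_int_of_two_pi {n : ℤ} {x : ℝ} (h : x = n * (2 * π)) (h1 : 0 < x)
    (h2 : x < 2 * π) : False := by
  have h0 := int_eq_zero_of_two_pi h (by linarith [Real.pi_pos]) h2
  subst h0
  simp at h
  linarith

/-- For unit vectors `v, x` with `⟪v, x⟫² < 1` the projection `perpTo v x` is nonzero. [folklore] -/
theorem perpTo_ne_zero_of_unit {v x : E3} (hv : ‖v‖ = 1) (hx : ‖x‖ = 1)
    (h : ⟪v, x⟫ ^ 2 < 1) : perpTo v x ≠ 0 := by
  rw [← norm_pos_iff]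
  have h2 : 0 < ‖perpTo v x‖ ^ 2 := by rw [norm_perpTo_sq_of_norm_eq_one hv hx]; linarith
  exact lt_of_le_of_ne (norm_nonneg _) fun h0 => by rw [← h0] at h2; simp at h2

/-- A turn whose angle lies strictly between `0` and `π` has nonzero determinant. [folklore] -/
theorem orient3_ne_zero_of_angle {v x y : E3} (hv : ‖v‖ = 1) (hx : perpTo v x ≠ 0)
    (hy : perpTo v y ≠ 0) (h0 : 0 < angle (perpTo v x) (perpTo v y))
    (hπ : angle (perpTo v x) (perpTo v y) < π) : orient3 v x y ≠ 0 := by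
  intro h
  have habs := abs_arg_turnZ hv hx hy
  have hreal : turnZ[v](x, y) = ((pdot[v](x, y) : ℝ) : ℂ) := by
    apply Complex.ext <;> simp [h]
  rw [hreal] at habs
  rcases le_or_gt 0 (pdot[v](x, y)) with hp | hp
  · rw [Complex.arg_ofReal_of_nonneg hp, abs_zero] at habs
    linarith
  · rw [Complex.arg_ofReal_of_neg hp, abs_of_pos Real.pi_pos] at habs
    linarith

/-- A turn with argument in `(0, π)` is positively oriented. [folklore] -/
private theorem orient3_pos_of_arg {v x y : E3} (h0 : 0 < (turnZ[v](x, y)).arg)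
    (hπ : (turnZ[v](x, y)).arg < π) : 0 < orient3 v x y := by
  by_contra h
  rcases lt_or_eq_of_le (le_of_not_gt h) with hlt | heq
  · have := Complex.arg_neg_iff.2 (show (turnZ[v](x, y)).im < 0 from hlt)
    linarith
  · have him : (turnZ[v](x, y)).im = 0 := heq
    rcases le_or_gt 0 (turnZ[v](x, y)).re with hre | hre
    · have := Complex.arg_eq_zero_iff.2 ⟨hre, him⟩
      linarith
    · have := Complex.arg_eq_pi_iff.2 ⟨hre, him⟩
      linarith

/-- **The four bonded directions around a shell vertex** (`v` unit; neighbours `a, w, w', b`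
with the turns `a → w → w' → b` of angles `T₁, T₂, T₃ ∈ [Tm, TM]`, `π/3 < Tm`, `TM < π/2`, the
first turn positively oriented, and the remaining angle `θ = ∠(p b, p a) > 2 TM − Tm`): all four
turns are positively oriented and `θ = 2π − T₁ − T₂ − T₃`.  (Winding number bookkeeping: the
four signed angles add up to a multiple of `2π`.) [folklore] -/
private theorem vertex4_pos {v a w w' b : E3} (hv : ‖v‖ = 1) (ha : perpTo v a ≠ 0)
    (hw : perpTo v w ≠ 0) (hw' : perpTo v w' ≠ 0) (hb : perpTo v b ≠ 0) {Tm TM : ℝ}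
    (hTm : π / 3 < Tm) (hTM : TM < π / 2)
    (h1 : Tm ≤ angle (perpTo v a) (perpTo v w) ∧ angle (perpTo v a) (perpTo v w) ≤ TM)
    (h2 : Tm ≤ angle (perpTo v w) (perpTo v w') ∧ angle (perpTo v w) (perpTo v w') ≤ TM)
    (h3 : Tm ≤ angle (perpTo v w') (perpTo v b) ∧ angle (perpTo v w') (perpTo v b) ≤ TM)
    (hθ : 2 * TM - Tm < angle (perpTo v b) (perpTo v a)) (hs1 : 0 < orient3 v a w) :
    0 < orient3 v w w' ∧ 0 < orient3 v w' b ∧ 0 < orient3 v b a ∧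
      angle (perpTo v b) (perpTo v a) = 2 * π - (angle (perpTo v a) (perpTo v w) +
        angle (perpTo v w) (perpTo v w') + angle (perpTo v w') (perpTo v b)) := by
  have hπ := Real.pi_pos
  set T1 := angle (perpTo v a) (perpTo v w) with hT1
  set T2 := angle (perpTo v w) (perpTo v w') with hT2
  set T3 := angle (perpTo v w') (perpTo v b) with hT3
  set θ := angle (perpTo v b) (perpTo v a) with hθdef
  have hθπ : θ ≤ π := angle_le_pi _ _
  obtain ⟨n, hn⟩ := turnZ_cycle4 hv ha hw hw' hb
  have e1 : (turnZ[v](a, w)).arg = T1 := arg_turnZ_of_pos hv ha hw hs1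
  have n2 : orient3 v w w' ≠ 0 :=
    orient3_ne_zero_of_angle hv hw hw' (by linarith [h2.1]) (by linarith [h2.2])
  have n3 : orient3 v w' b ≠ 0 :=
    orient3_ne_zero_of_angle hv hw' hb (by linarith [h3.1]) (by linarith [h3.2])
  rw [e1] at hn
  rcases lt_or_gt_of_ne n2 with s2 | s2 <;> rcases lt_or_gt_of_ne n3 with s3 | s3 <;>
    [rw [arg_turnZ_of_neg hv hw hw' s2, arg_turnZ_of_neg hv hw' hb s3] at hn;
     rw [arg_turnZ_of_neg hv hw hw' s2, arg_turnZ_of_pos hv hw' hb s3] at hn;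
     rw [arg_turnZ_of_pos hv hw hw' s2, arg_turnZ_of_neg hv hw' hb s3] at hn;
     rw [arg_turnZ_of_pos hv hw hw' s2, arg_turnZ_of_pos hv hw' hb s3] at hn] <;>
    rcases arg_turnZ_eq_or hv hb ha with e4 | e4 <;> rw [e4] at hn
  -- (−,−,+θ)
  · exfalso
    have h0 := int_eq_zero_of_two_pi hn (by linarith [h1.1, h2.2, h3.2]) (by linarith [h1.2, h2.1])
    subst h0; simp at hn; linarith [h1.1, angle_nonneg (perpTo v b) (perpTo v a)]
  -- (−,−,−θ)
  · exfalso
    have h0 := int_eq_zero_of_two_pi hn (by linarith [h1.1, h2.2, h3.2]) (by linarith [h1.2, h2.1])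
    subst h0; simp at hn; linarith [h1.1, h2.2, h3.2]
  -- (−,+,+θ)
  · exfalso
    have h0 := int_eq_zero_of_two_pi hn (by linarith [h1.1, h2.2, h3.1, angle_nonneg (perpTo v b) (perpTo v a)])
      (by linarith [h1.2, h2.1, h3.2])
    subst h0; simp at hn; linarith [h1.1, h2.2, h3.1, angle_nonneg (perpTo v b) (perpTo v a)]
  -- (−,+,−θ)
  · exfalso
    have h0 := int_eq_zero_of_two_pi hn (by linarith [h1.1, h2.2, h3.1]) (by linarith [h1.2, h2.1, h3.2])
    subst h0; simp at hn; linarith [h1.2, h2.1, h3.2]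
  -- (+,−,+θ)
  · exfalso
    have h0 := int_eq_zero_of_two_pi hn (by linarith [h1.1, h2.1, h3.2, angle_nonneg (perpTo v b) (perpTo v a)])
      (by linarith [h1.2, h2.2, h3.1])
    subst h0; simp at hn; linarith [h1.1, h2.1, h3.2, angle_nonneg (perpTo v b) (perpTo v a)]
  -- (+,−,−θ)
  · exfalso
    have h0 := int_eq_zero_of_two_pi hn (by linarith [h1.1, h2.1, h3.2]) (by linarith [h1.2, h2.2, h3.1])
    subst h0; simp at hn; linarith [h1.2, h2.2, h3.1]
  -- (+,+,+θ): the genuine case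
  · have h0 := int_eq_one_of_two_pi hn (by linarith [h1.1, h2.1, h3.1, angle_nonneg (perpTo v b) (perpTo v a)])
      (by linarith [h1.2, h2.2, h3.2])
    subst h0
    simp at hn
    have hθeq : θ = 2 * π - (T1 + T2 + T3) := by linarith
    refine ⟨s2, s3, ?_, hθeq⟩
    apply orient3_pos_of_arg
    · rw [e4]; linarith [h1.2, h2.2, h3.2]
    · rw [e4]; linarith [h1.1, h2.1, h3.1]
  -- (+,+,−θ)
  · exfalso
    exact no_int_of_two_pi hn (by linarith [h1.1, h2.1, h3.1]) (by linarith [h1.2, h2.2, h3.2])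


/-- `perpTo` is even in its first argument. [folklore] -/
theorem perpTo_neg_left (v x : E3) : perpTo (-v) x = perpTo v x := by
  simp only [perpTo_def, inner_neg_left, inner_neg_right, neg_neg, smul_neg, neg_div, neg_smul]

/-- `orient3` is odd in its first argument. [folklore] -/
private theorem orient3_neg_left (v x y : E3) : orient3 (-v) x y = -orient3 v x y := by
  rw [show -v = (-1 : ℝ) • v by simp, orient3_smul_left]; ring

/-- The general form of `vertex4_pos` (no sign assumed on the first turn): the four turns have a
common orientation `ε = ±1` and `θ = 2π − T₁ − T₂ − T₃`. [folklore] -/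
private theorem vertex4 {v a w w' b : E3} (hv : ‖v‖ = 1) (ha : perpTo v a ≠ 0)
    (hw : perpTo v w ≠ 0) (hw' : perpTo v w' ≠ 0) (hb : perpTo v b ≠ 0) {Tm TM : ℝ}
    (hTm : π / 3 < Tm) (hTM : TM < π / 2)
    (h1 : Tm ≤ angle (perpTo v a) (perpTo v w) ∧ angle (perpTo v a) (perpTo v w) ≤ TM)
    (h2 : Tm ≤ angle (perpTo v w) (perpTo v w') ∧ angle (perpTo v w) (perpTo v w') ≤ TM)
    (h3 : Tm ≤ angle (perpTo v w') (perpTo v b) ∧ angle (perpTo v w') (perpTo v b) ≤ TM)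
    (hθ : 2 * TM - Tm < angle (perpTo v b) (perpTo v a)) :
    (∃ ε : ℝ, (ε = 1 ∨ ε = -1) ∧ 0 < ε * orient3 v a w ∧ 0 < ε * orient3 v w w' ∧
      0 < ε * orient3 v w' b ∧ 0 < ε * orient3 v b a) ∧
      angle (perpTo v b) (perpTo v a) = 2 * π - (angle (perpTo v a) (perpTo v w) +
        angle (perpTo v w) (perpTo v w') + angle (perpTo v w') (perpTo v b)) := by
  have n1 : orient3 v a w ≠ 0 :=
    orient3_ne_zero_of_angle hv ha hw (by linarith [h1.1, Real.pi_pos]) (by linarith [h1.2])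
  rcases lt_or_gt_of_ne n1 with s1 | s1
  · -- mirror: replace `v` by `−v`
    have hv' : ‖-v‖ = 1 := by rw [norm_neg, hv]
    have key := vertex4_pos (v := -v) (a := a) (w := w) (w' := w') (b := b) hv'
      (by rwa [perpTo_neg_left]) (by rwa [perpTo_neg_left]) (by rwa [perpTo_neg_left])
      (by rwa [perpTo_neg_left]) hTm hTM (by rwa [perpTo_neg_left, perpTo_neg_left])
      (by rwa [perpTo_neg_left, perpTo_neg_left]) (by rwa [perpTo_neg_left, perpTo_neg_left])
      (by rwa [perpTo_neg_left, perpTo_neg_left])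
      (by rw [orient3_neg_left]; linarith)
    simp only [perpTo_neg_left, orient3_neg_left] at key
    obtain ⟨k2, k3, k4, kθ⟩ := key
    exact ⟨⟨-1, Or.inr rfl, by linarith, by linarith, by linarith, by linarith⟩, kθ⟩
  · obtain ⟨k2, k3, k4, kθ⟩ := vertex4_pos hv ha hw hw' hb hTm hTM h1 h2 h3 hθ s1
    exact ⟨⟨1, Or.inl rfl, by linarith, by linarith, by linarith, by linarith⟩, kθ⟩

/-- **The six directions around an odd ring vertex.**  About the unit vector `v`, six
directions `a, w, w', b, c, d` whose turns `a → w → w' → b → c` and `d → a` are positively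
oriented, with `T₁, T₂, T₃ ∈ [Tm, TM]` (`π/3 < Tm`, `TM < π/2`) the angles of the first three
turns, `β = ∠(p b, p c) < π/2`, `β' = ∠(p d, p a) < π/2` and `ι = ∠(p c, p d) > π/2`: then
`T₁ + T₂ + T₃ + β + ι + β' = 2π` (the turn `c → d` cannot be negatively oriented). [folklore] -/
private theorem vertex6 {v a w w' b c d : E3} (hv : ‖v‖ = 1) (ha : perpTo v a ≠ 0)
    (hw : perpTo v w ≠ 0) (hw' : perpTo v w' ≠ 0) (hb : perpTo v b ≠ 0) (hc : perpTo v c ≠ 0)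
    (hd : perpTo v d ≠ 0) {Tm TM : ℝ} (hTm : π / 3 < Tm) (hTM : TM < π / 2)
    (h1 : Tm ≤ angle (perpTo v a) (perpTo v w) ∧ angle (perpTo v a) (perpTo v w) ≤ TM)
    (h2 : Tm ≤ angle (perpTo v w) (perpTo v w') ∧ angle (perpTo v w) (perpTo v w') ≤ TM)
    (h3 : Tm ≤ angle (perpTo v w') (perpTo v b) ∧ angle (perpTo v w') (perpTo v b) ≤ TM)
    (hs1 : 0 < orient3 v a w) (hs2 : 0 < orient3 v w w') (hs3 : 0 < orient3 v w' b)
    (hs4 : 0 < orient3 v b c) (hs6 : 0 < orient3 v d a)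
    (hβ : angle (perpTo v b) (perpTo v c) < π / 2) (hβ' : angle (perpTo v d) (perpTo v a) < π / 2)
    (hι : π / 2 < angle (perpTo v c) (perpTo v d)) :
    angle (perpTo v a) (perpTo v w) + angle (perpTo v w) (perpTo v w') +
      angle (perpTo v w') (perpTo v b) + angle (perpTo v b) (perpTo v c) +
      angle (perpTo v c) (perpTo v d) + angle (perpTo v d) (perpTo v a) = 2 * π := by
  have hπ := Real.pi_pos
  obtain ⟨n, hn⟩ := turnZ_cycle6 hv ha hw hw' hb hc hd
  rw [arg_turnZ_of_pos hv ha hw hs1, arg_turnZ_of_pos hv hw hw' hs2,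
    arg_turnZ_of_pos hv hw' hb hs3, arg_turnZ_of_pos hv hb hc hs4,
    arg_turnZ_of_pos hv hd ha hs6] at hn
  have hιπ : angle (perpTo v c) (perpTo v d) ≤ π := angle_le_pi _ _
  have hβ0 : 0 ≤ angle (perpTo v b) (perpTo v c) := angle_nonneg _ _
  have hβ'0 : 0 ≤ angle (perpTo v d) (perpTo v a) := angle_nonneg _ _
  rcases arg_turnZ_eq_or hv hc hd with e5 | e5 <;> rw [e5] at hn
  · have h0 := int_eq_one_of_two_pi hn (by linarith [h1.1, h2.1, h3.1])
      (by linarith [h1.2, h2.2, h3.2])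
    subst h0
    simp at hn
    linarith
  · exfalso
    exact no_int_of_two_pi hn (by linarith [h1.1, h2.1, h3.1]) (by linarith [h1.2, h2.2, h3.2])


/-! ### Part 3. Windows for the normalised points; the ear and the inner triangle -/

/-- Upper cosine window: radii `r, s ∈ [0.98, 1.02]`, distance `d ≥ 0.98` give
`(r² + s² − d²)/2 ≤ c₀ · r s` with `c₀ = 2801/5202`. [folklore] -/
private theorem cos_le_c0 {r s d : ℝ} (hr : 1 - 1 / 50 ≤ r ∧ r ≤ 1 + 1 / 50)
    (hs : 1 - 1 / 50 ≤ s ∧ s ≤ 1 + 1 / 50) (hd : 1 - 1 / 50 ≤ d) :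
    (r ^ 2 + s ^ 2 - d ^ 2) / 2 ≤ 2801 / 5202 * (r * s) := by
  -- adapted from `stub_tCornerMin` (`tCornerMin_cos_le_upper` with `R = S = 1.02`)
  have hd2 : (1 - 1 / 50) ^ 2 ≤ d ^ 2 := pow_le_pow_left₀ (by norm_num) hd 2
  have h1 : 0 ≤ d ^ 2 - (1 - 1 / 50) ^ 2 := sub_nonneg.2 hd2
  have h2 : 0 ≤ r * ((1 + 1 / 50 - s) * (s * (1 + 1 / 50) - (1 + 1 / 50) ^ 2 + (1 - 1 / 50) ^ 2)) :=
    mul_nonneg (by linarith [hr.1]) (mul_nonneg (by linarith [hs.2]) (by nlinarith [hs.1]))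
  have h3 : 0 ≤ (1 + 1 / 50 - r) * ((1 + 1 / 50) * r - s ^ 2 + (1 - 1 / 50) ^ 2) :=
    mul_nonneg (by linarith [hr.2]) (by nlinarith [hs.1, hs.2, hr.1])
  nlinarith [h1, h2, h3]

/-- Lower cosine window: radii `r, s ∈ [0.98, 1.02]`, distance `d ≤ 1.02` give
`c₁ · r s ≤ (r² + s² − d²)/2` with `c₁ = 2201/4802`. [folklore] -/
private theorem c1_le_cos {r s d : ℝ} (hr : 1 - 1 / 50 ≤ r ∧ r ≤ 1 + 1 / 50)
    (hs : 1 - 1 / 50 ≤ s ∧ s ≤ 1 + 1 / 50) (hd0 : 0 ≤ d) (hd : d ≤ 1 + 1 / 50) :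
    2201 / 4802 * (r * s) ≤ (r ^ 2 + s ^ 2 - d ^ 2) / 2 := by
  -- adapted from `stub_tCornerMin` (`tCornerMin_lower_le_cos` with `R₁ = S₁ = 0.98`)
  have hd2 : d ^ 2 ≤ (1 + 1 / 50) ^ 2 := pow_le_pow_left₀ hd0 hd 2
  have h1 : 0 ≤ (1 + 1 / 50) ^ 2 - d ^ 2 := sub_nonneg.2 hd2
  have h2 : 0 ≤ (r - (1 - 1 / 50)) * (r * (1 - 1 / 50) + (1 + 1 / 50) ^ 2 - s ^ 2) :=
    mul_nonneg (by linarith [hr.1]) (by nlinarith [hs.1, hs.2, hr.1])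
  have h3 : 0 ≤ r * ((s - (1 - 1 / 50)) * (s * (1 - 1 / 50) + (1 + 1 / 50) ^ 2 - (1 - 1 / 50) ^ 2)) :=
    mul_nonneg (by linarith [hr.1]) (mul_nonneg (by linarith [hs.1]) (by nlinarith [hs.1]))
  nlinarith [h1, h2, h3]

/-- Far cosine window: radii `r, s ∈ [0.98, 1.02]`, distance `d ≥ 1.26` give
`(r² + s² − d²)/2 ≤ c_far · r s` with `c_far = 1233/5202`. [folklore] -/
private theorem cos_le_cfar {r s d : ℝ} (hr : 1 - 1 / 50 ≤ r ∧ r ≤ 1 + 1 / 50)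
    (hs : 1 - 1 / 50 ≤ s ∧ s ≤ 1 + 1 / 50) (hd : 63 / 50 ≤ d) :
    (r ^ 2 + s ^ 2 - d ^ 2) / 2 ≤ 1233 / 5202 * (r * s) := by
  have hd2 : (63 / 50 : ℝ) ^ 2 ≤ d ^ 2 := pow_le_pow_left₀ (by norm_num) hd 2
  have h1 : 0 ≤ d ^ 2 - (63 / 50) ^ 2 := sub_nonneg.2 hd2
  have h2 : 0 ≤ r * ((1 + 1 / 50 - s) * (s * (1 + 1 / 50) - (1 + 1 / 50) ^ 2 + (63 / 50) ^ 2)) :=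
    mul_nonneg (by linarith [hr.1]) (mul_nonneg (by linarith [hs.2]) (by nlinarith [hs.1]))
  have h3 : 0 ≤ (1 + 1 / 50 - r) * ((1 + 1 / 50) * r - s ^ 2 + (63 / 50) ^ 2) :=
    mul_nonneg (by linarith [hr.2]) (by nlinarith [hs.1, hs.2, hr.1])
  nlinarith [h1, h2, h3]

/-- The inner product in terms of the distance (polarisation). [folklore] -/
private theorem inner_eq_of_dist (p q : E3) :
    ⟪p, q⟫ = (‖p‖ ^ 2 + ‖q‖ ^ 2 - dist p q ^ 2) / 2 := by
  rw [dist_eq_norm, norm_sub_sq_real]; ring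

/-- The normalised direction of a point. -/
local notation "nrm(" p ")" => ((‖p‖⁻¹ : ℝ) • p)

/-- The normalised direction is a unit vector. [folklore] -/
theorem norm_nrm {p : E3} (hp : 0 < ‖p‖) : ‖nrm(p)‖ = 1 := by
  rw [norm_smul, norm_inv, norm_norm, inv_mul_cancel₀ hp.ne']

/-- The inner product of two normalised directions. [folklore] -/
private theorem inner_nrm {p q : E3} (hp : 0 < ‖p‖) (hq : 0 < ‖q‖) :
    ⟪nrm(p), nrm(q)⟫ = ⟪p, q⟫ / (‖p‖ * ‖q‖) := by
  rw [real_inner_smul_left, real_inner_smul_right]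
  field_simp

/-- **Cosine window of a bond** for the normalised points: `⟪u, u'⟫ ∈ [c₁, c₀]`. [folklore] -/
theorem bond_inner {p q : E3} (hp : 1 - 1 / 50 ≤ ‖p‖ ∧ ‖p‖ ≤ 1 + 1 / 50)
    (hq : 1 - 1 / 50 ≤ ‖q‖ ∧ ‖q‖ ≤ 1 + 1 / 50)
    (hd : 1 - 1 / 50 ≤ dist p q ∧ dist p q ≤ 1 + 1 / 50) :
    2201 / 4802 ≤ ⟪nrm(p), nrm(q)⟫ ∧ ⟪nrm(p), nrm(q)⟫ ≤ 2801 / 5202 := by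
  have hrp : 0 < ‖p‖ := by linarith [hp.1]
  have hrq : 0 < ‖q‖ := by linarith [hq.1]
  have hpq : 0 < ‖p‖ * ‖q‖ := mul_pos hrp hrq
  rw [inner_nrm hrp hrq, inner_eq_of_dist p q, le_div_iff₀ hpq, div_le_iff₀ hpq]
  exact ⟨c1_le_cos hp hq dist_nonneg hd.2, cos_le_c0 hp hq hd.1⟩

/-- **Cosine window of a far pair** for the normalised points: `⟪u, u'⟫ ≤ c_far`. [folklore] -/
theorem far_inner {p q : E3} (hp : 1 - 1 / 50 ≤ ‖p‖ ∧ ‖p‖ ≤ 1 + 1 / 50)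
    (hq : 1 - 1 / 50 ≤ ‖q‖ ∧ ‖q‖ ≤ 1 + 1 / 50) (hd : 63 / 50 ≤ dist p q) :
    ⟪nrm(p), nrm(q)⟫ ≤ 1233 / 5202 := by
  have hrp : 0 < ‖p‖ := by linarith [hp.1]
  have hrq : 0 < ‖q‖ := by linarith [hq.1]
  have hpq : 0 < ‖p‖ * ‖q‖ := mul_pos hrp hrq
  rw [inner_nrm hrp hrq, inner_eq_of_dist p q, div_le_iff₀ hpq]
  exact cos_le_cfar hp hq hd

/-- `perpTo` is `0`-homogeneous in its first argument. [folklore] -/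
private theorem perpTo_smul_left' (p q : E3) {c : ℝ} (hc : c ≠ 0) :
    perpTo (c • p) q = perpTo p q := by
  -- adapted from `stub_fanAngles` (`perpTo_smul_left`)
  rw [perpTo_def, perpTo_def, real_inner_smul_left, real_inner_smul_left, real_inner_smul_right,
    smul_smul]
  rcases eq_or_ne p 0 with rfl | hp
  · simp
  · have hpp : ⟪p, p⟫ ≠ 0 := fun h => hp (inner_self_eq_zero.1 h)
    congr 2
    field_simp

/-- The corner angles are unchanged by normalising the three points. [folklore] -/
theorem angle_perpTo_nrm {v a b : E3} (hv : 0 < ‖v‖) (ha : 0 < ‖a‖) (hb : 0 < ‖b‖) :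
    angle (perpTo (nrm(v)) (nrm(a))) (perpTo (nrm(v)) (nrm(b))) = angle (perpTo v a) (perpTo v b) := by
  rw [perpTo_smul_left' v _ (inv_ne_zero hv.ne'),
    perpTo_smul_left' v _ (inv_ne_zero hv.ne'), perpTo_smul_right, perpTo_smul_right,
    angle_smul_left_of_pos _ _ (inv_pos.2 ha), angle_smul_right_of_pos _ _ (inv_pos.2 hb)]

/-- The determinant changes by a positive factor under normalisation. [folklore] -/
private theorem orient3_nrm (a b c : E3) :
    orient3 (nrm(a)) (nrm(b)) (nrm(c)) = (‖a‖⁻¹ * ‖b‖⁻¹ * ‖c‖⁻¹) * orient3 a b c := by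
  rw [orient3_smul_left, orient3_smul_mid, orient3_smul_right]; ring

/-- The real core of the ear estimate: for leg cosines `z, z' ∈ [c₁, c₀]`, apex cosine
`κ ∈ [−1, 0]` and `Q = ‖p b‖ ‖p c‖ ≥ 1 − c₀²`,
`2 P₀² (1 + z z' + Q κ) ≤ (1 − z)(1 − z')(1 + 2 P₀ κ + P₀²)` (`P₀ = 2401/8003 = (1−c₀)/(1+c₀)`),
with equality for `z = z' = c₀`. [folklore] -/
private theorem ear_core {z z' κ Q : ℝ} (hz : 2201 / 4802 ≤ z ∧ z ≤ 2801 / 5202)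
    (hz' : 2201 / 4802 ≤ z' ∧ z' ≤ 2801 / 5202) (hκ1 : -1 ≤ κ) (hκ0 : κ ≤ 0)
    (hQ : 19215203 / 27060804 ≤ Q) :
    2 * (2401 / 8003) ^ 2 * (1 + z * z' + Q * κ) ≤
      (1 - z) * (1 - z') * (1 + 2 * (2401 / 8003) * κ + (2401 / 8003) ^ 2) := by
  set P : ℝ := 2401 / 8003 with hP
  -- `A ≥ 0`
  have hA : 0 ≤ (1 - z) * (1 - z') * (1 + P ^ 2) - 2 * P ^ 2 * (1 + z * z') := by
    have e1 : 0 ≤ (2801 / 5202 - z) * ((1 - z') * (1 + P ^ 2) + 2 * P ^ 2 * z') :=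
      mul_nonneg (by linarith [hz.2]) (by rw [hP]; nlinarith [hz'.1, hz'.2])
    have e2 : 0 ≤ (2801 / 5202 - z') * ((1 - 2801 / 5202) * (1 + P ^ 2) + 2 * P ^ 2 * (2801 / 5202)) :=
      mul_nonneg (by linarith [hz'.2]) (by rw [hP]; norm_num)
    rw [hP] at e1 e2 ⊢
    nlinarith [e1, e2]
  -- `f ≥ 0`
  have hf : 0 ≤ (1 - z) * (1 - z') * (1 - P) ^ 2 -
      2 * P ^ 2 * (z * z' + (2801 / 5202) ^ 2) := by
    have e1 : 0 ≤ (2801 / 5202 - z) * ((1 - z') * (1 - P) ^ 2 + 2 * P ^ 2 * z') :=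
      mul_nonneg (by linarith [hz.2]) (by rw [hP]; nlinarith [hz'.1, hz'.2])
    have e2 : 0 ≤ (2801 / 5202 - z') * ((1 - 2801 / 5202) * (1 - P) ^ 2 + 2 * P ^ 2 * (2801 / 5202)) :=
      mul_nonneg (by linarith [hz'.2]) (by rw [hP]; norm_num)
    rw [hP] at e1 e2 ⊢
    nlinarith [e1, e2]
  rcases le_or_gt (2 * P * ((1 - z) * (1 - z')) - 2 * P ^ 2 * Q) 0 with hB | hB
  · -- `B ≤ 0`: `κ B ≥ 0`
    have : 0 ≤ κ * (2 * P * ((1 - z) * (1 - z')) - 2 * P ^ 2 * Q) :=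
      mul_nonneg_of_nonpos_of_nonpos hκ0 hB
    rw [hP] at this hA ⊢
    nlinarith [this, hA]
  · -- `B > 0`: worst at `κ = −1`
    have : -(2 * P * ((1 - z) * (1 - z')) - 2 * P ^ 2 * Q) ≤
        κ * (2 * P * ((1 - z) * (1 - z')) - 2 * P ^ 2 * Q) := by nlinarith
    rw [hP] at this hf hB ⊢
    nlinarith [this, hf, hQ]

/-- Monotonicity of the isosceles-ear bound `φ(w) = 2P₀²(1 − w²)/(1 − 2P₀ w + P₀²)` in the
form used below: for `3/5 ≤ W ≤ 1` and `−W ≤ κ ≤ 0`, `φ(W) ≤ φ(−κ)` (cleared of the positive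
denominators). [folklore] -/
private theorem ear_phi_mono {W κ : ℝ} (hW0 : 3 / 5 ≤ W) (hW1 : W ≤ 1) (hκW : -W ≤ κ)
    (hκ0 : κ ≤ 0) :
    (1 - W ^ 2) * (1 + 2 * (2401 / 8003) * κ + (2401 / 8003) ^ 2) ≤
      (1 - κ ^ 2) * (1 - 2 * (2401 / 8003) * W + (2401 / 8003) ^ 2) := by
  have k1 : 0 ≤ (1 + (2401 / 8003 : ℝ) ^ 2) * W - 2 * (2401 / 8003) := by linarith
  have k2 : 0 ≤ (-κ) * ((1 + (2401 / 8003 : ℝ) ^ 2) - 2 * (2401 / 8003) * W) :=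
    mul_nonneg (by linarith) (by nlinarith)
  have k3 : 0 ≤ (W + κ) * ((1 + (2401 / 8003 : ℝ) ^ 2) * (W - κ) - 2 * (2401 / 8003) * (1 - W * κ)) :=
    mul_nonneg (by linarith) (by nlinarith [k1, k2])
  have key : (1 - κ ^ 2) * (1 - 2 * (2401 / 8003) * W + (2401 / 8003) ^ 2) -
      (1 - W ^ 2) * (1 + 2 * (2401 / 8003) * κ + (2401 / 8003) ^ 2) =
      (W + κ) * ((1 + (2401 / 8003 : ℝ) ^ 2) * (W - κ) - 2 * (2401 / 8003) * (1 - W * κ)) := by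
    ring
  linarith [key, k3]

/-- The ear estimate in real variables: leg cosines `z, z'`, base cosine `y`, apex cosine
`κ ∈ [−W, 0]`, `Q = ‖p b‖ ‖p c‖` (`Q² = (1 − z²)(1 − z'²)`, `y − z z' = κ Q`):
`φ(W) ≤ F(y, z', z)`. [folklore] -/
private theorem ear_real {z z' y κ Q W : ℝ} (hz : 2201 / 4802 ≤ z ∧ z ≤ 2801 / 5202)
    (hz' : 2201 / 4802 ≤ z' ∧ z' ≤ 2801 / 5202) (hy1 : -1 < y) (hQ0 : 0 ≤ Q)
    (hQ2 : Q ^ 2 = (1 - z ^ 2) * (1 - z' ^ 2)) (hcos : κ * Q = y - z * z') (hκ1 : -1 ≤ κ)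
    (hW0 : 3 / 5 ≤ W) (hW1 : W ≤ 1) (hκW : -W ≤ κ) (hκ0 : κ ≤ 0) :
    2 * (2401 / 8003) ^ 2 * (1 - W ^ 2) / (1 - 2 * (2401 / 8003) * W + (2401 / 8003) ^ 2) ≤
      eulerF y z' z := by
  -- `Q ≥ 1 − c₀²`
  have hQ : 19215203 / 27060804 ≤ Q := by
    have h3 : (19215203 / 27060804 : ℝ) ^ 2 ≤ Q ^ 2 := by
      rw [hQ2, pow_two]
      exact mul_le_mul (by nlinarith [hz.1, hz.2]) (by nlinarith [hz'.1, hz'.2]) (by norm_num)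
        (by nlinarith [hz.1, hz.2])
    exact (pow_le_pow_iff_left₀ (by norm_num) hQ0 two_ne_zero).1 h3
  have hz1 : 0 < 1 + z := by linarith [hz.1]
  have hz1' : 0 < 1 + z' := by linarith [hz'.1]
  have core := ear_core hz hz' hκ1 hκ0 hQ
  have hG : eulerGram y z' z = Q ^ 2 * (1 - κ ^ 2) := by
    unfold eulerGram
    have e1 : (1 : ℝ) - y ^ 2 - z' ^ 2 - z ^ 2 + 2 * y * z' * z =
        (1 - z ^ 2) * (1 - z' ^ 2) - (y - z * z') ^ 2 := by ring
    rw [e1, ← hcos, mul_pow, hQ2]; ring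
  have hden : 0 < (1 + y) * (1 + z') * (1 + z) := mul_pos (mul_pos (by linarith) hz1') hz1
  have h2P : (0 : ℝ) ≤ 2 * (2401 / 8003) := by norm_num
  have hD : 0 < 1 + 2 * (2401 / 8003) * κ + (2401 / 8003 : ℝ) ^ 2 := by
    have := mul_le_mul_of_nonneg_left hκ1 h2P
    nlinarith [this]
  have hD1 : 0 < 1 - 2 * (2401 / 8003) * W + (2401 / 8003 : ℝ) ^ 2 := by
    have := mul_le_mul_of_nonneg_left hW1 h2P
    nlinarith [this]
  have hF : 2 * (2401 / 8003 : ℝ) ^ 2 * (1 - κ ^ 2) / (1 + 2 * (2401 / 8003) * κ + (2401 / 8003) ^ 2)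
      ≤ eulerF y z' z := by
    rw [eulerF, hG, div_le_div_iff₀ hD hden]
    have h1y : 1 + y = 1 + z * z' + Q * κ := by linarith [hcos]
    have hk : 0 ≤ (1 - κ ^ 2) * ((1 + z) * (1 + z')) :=
      mul_nonneg (by nlinarith) (mul_pos hz1 hz1').le
    have step := mul_le_mul_of_nonneg_right core hk
    calc 2 * (2401 / 8003 : ℝ) ^ 2 * (1 - κ ^ 2) * ((1 + y) * (1 + z') * (1 + z))
        = 2 * (2401 / 8003) ^ 2 * (1 + z * z' + Q * κ) * ((1 - κ ^ 2) * ((1 + z) * (1 + z'))) := by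
          rw [h1y]; ring
      _ ≤ (1 - z) * (1 - z') * (1 + 2 * (2401 / 8003) * κ + (2401 / 8003) ^ 2) *
            ((1 - κ ^ 2) * ((1 + z) * (1 + z'))) := step
      _ = Q ^ 2 * (1 - κ ^ 2) * (1 + 2 * (2401 / 8003) * κ + (2401 / 8003) ^ 2) := by
          rw [hQ2]; ring
  refine le_trans ?_ hF
  rw [div_le_div_iff₀ hD1 hD]
  have hm := ear_phi_mono hW0 hW1 hκW hκ0
  have := mul_le_mul_of_nonneg_left hm (by norm_num : (0 : ℝ) ≤ 2 * (2401 / 8003) ^ 2)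
  linarith [this]

/-- **The ear estimate.**  A spherical triangle with unit vertices `a, b, c`, legs
`⟪a, b⟫, ⟪a, c⟫ ∈ [c₁, c₀]` and apex angle `C = ∠(p_a b, p_a c)` with `−W ≤ cos C ≤ 0`
(`3/5 ≤ W ≤ 1`) has excess at least `e` whenever `e ≤ π` and
`1 − cos e ≤ φ(W) = 2 P₀² (1 − W²)/(1 − 2 P₀ W + P₀²)` — `φ(W)` being `1 − cos` of the excess of
the isosceles triangle with legs of cosine `c₀` and apex cosine `−W` (Euler's formula
`1 − cos E = F`; the excess grows with the legs and decreases with the apex angle here). [folklore] -/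
private theorem ear_excess {a b c : E3} (ha : ‖a‖ = 1) (hb : ‖b‖ = 1) (hc : ‖c‖ = 1)
    (hab : 2201 / 4802 ≤ ⟪a, b⟫ ∧ ⟪a, b⟫ ≤ 2801 / 5202)
    (hac : 2201 / 4802 ≤ ⟪a, c⟫ ∧ ⟪a, c⟫ ≤ 2801 / 5202) (hli : LinearIndependent ℝ ![a, b, c])
    {W : ℝ} (hW0 : 3 / 5 ≤ W) (hW1 : W ≤ 1)
    (hκW : -W ≤ Real.cos (angle (perpTo a b) (perpTo a c)))
    (hκ0 : Real.cos (angle (perpTo a b) (perpTo a c)) ≤ 0) {e : ℝ} (heπ : e ≤ π)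
    (he : 1 - Real.cos e ≤ 2 * (2401 / 8003) ^ 2 * (1 - W ^ 2) /
      (1 - 2 * (2401 / 8003) * W + (2401 / 8003) ^ 2)) :
    e ≤ sphExcess a b c := by
  have hq2 : ‖perpTo a b‖ ^ 2 = 1 - ⟪a, b⟫ ^ 2 := norm_perpTo_sq_of_norm_eq_one ha hb
  have hq2' : ‖perpTo a c‖ ^ 2 = 1 - ⟪a, c⟫ ^ 2 := norm_perpTo_sq_of_norm_eq_one ha hc
  have hcos := cos_angle_perpTo_mul ha b c
  have hy1 : -1 < ⟪b, c⟫ := by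
    have := inner_sq_lt_one_of_linearIndependent hb hc (linearIndependent_pair_of_triple₂₃ hli)
    nlinarith [this]
  have hQ2 : (‖perpTo a b‖ * ‖perpTo a c‖) ^ 2 = (1 - ⟪a, b⟫ ^ 2) * (1 - ⟪a, c⟫ ^ 2) := by
    rw [mul_pow, hq2, hq2']
  have key := ear_real hab hac hy1 (by positivity) hQ2 hcos (Real.neg_one_le_cos _) hW0 hW1 hκW hκ0
  exact le_sphExcess_of_one_sub_cos_le ha hb hc hli heπ (he.trans key)

/-- **An angle of the inner triangle.**  For unit vectors `v, x, y` with `⟪x, y⟫ ≤ Yo`,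
`⟪v, x⟫ ≤ Ya`, `⟪v, y⟫ ≤ Yb`, all three bounds at most `Yh < 0`, and `⟪v, x⟫, ⟪v, y⟫ > −1`:
`∠(p_v x, p_v y) ≥ arccos ((Yo − Ya Yb)/(1 − Yh²))` (spherical law of cosines, the cosine
being increasing in each side-cosine on this range). [folklore] -/
private theorem inner_angle_bound {v x y : E3} (hv : ‖v‖ = 1) (hx : ‖x‖ = 1) (hy : ‖y‖ = 1)
    {Yo Ya Yb Yh : ℝ} (hYh : Yh < 0) (hoh : Yo ≤ Yh) (hah : Ya ≤ Yh) (hbh : Yb ≤ Yh)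
    (hxy : ⟪x, y⟫ ≤ Yo) (hvx : ⟪v, x⟫ ≤ Ya) (hvy : ⟪v, y⟫ ≤ Yb) (h1x : -1 < ⟪v, x⟫)
    (h1y : -1 < ⟪v, y⟫) :
    Real.arccos ((Yo - Ya * Yb) / (1 - Yh ^ 2)) ≤ angle (perpTo v x) (perpTo v y) := by
  have hpx : perpTo v x ≠ 0 := perpTo_ne_zero_of_unit hv hx (by nlinarith)
  have hpy : perpTo v y ≠ 0 := perpTo_ne_zero_of_unit hv hy (by nlinarith)
  have hnx : 0 < ‖perpTo v x‖ := norm_pos_iff.2 hpx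
  have hny : 0 < ‖perpTo v y‖ := norm_pos_iff.2 hpy
  set D := ‖perpTo v x‖ * ‖perpTo v y‖ with hD
  have hD0 : 0 < D := mul_pos hnx hny
  have hN : ⟪perpTo v x, perpTo v y⟫ = ⟪x, y⟫ - ⟪v, x⟫ * ⟪v, y⟫ :=
    inner_perpTo_perpTo_of_norm_eq_one hv x y
  have hprod : Ya * Yb ≤ ⟪v, x⟫ * ⟪v, y⟫ := by nlinarith
  have hN0 : ⟪x, y⟫ - ⟪v, x⟫ * ⟪v, y⟫ ≤ Yo - Ya * Yb := by linarith
  have hneg : Yo - Ya * Yb < 0 := by nlinarith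
  have hR : 0 < 1 - Yh ^ 2 := by nlinarith
  -- `D ≤ 1 − Yh²`
  have hDR : D ≤ 1 - Yh ^ 2 := by
    have hx2 : ‖perpTo v x‖ ^ 2 ≤ 1 - Yh ^ 2 := by
      rw [norm_perpTo_sq_of_norm_eq_one hv hx]; nlinarith
    have hy2 : ‖perpTo v y‖ ^ 2 ≤ 1 - Yh ^ 2 := by
      rw [norm_perpTo_sq_of_norm_eq_one hv hy]; nlinarith
    have hD2 : D ^ 2 ≤ (1 - Yh ^ 2) ^ 2 := by
      rw [hD, mul_pow, pow_two (1 - Yh ^ 2)]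
      exact mul_le_mul hx2 hy2 (by positivity) hR.le
    exact (pow_le_pow_iff_left₀ hD0.le hR.le two_ne_zero).1 hD2
  unfold angle
  apply Real.arccos_le_arccos
  rw [hN, div_le_div_iff₀ hD0 hR]
  nlinarith [hN0, hDR, hneg]


/-! ### Part 4. Numerical constants -/

/-- `cos (3 arccos q) = 4 q³ − 3 q`. [folklore] -/
private theorem cos_three_arccos {q : ℝ} (h1 : -1 ≤ q) (h2 : q ≤ 1) :
    Real.cos (3 * Real.arccos q) = 4 * q ^ 3 - 3 * q := by
  rw [Real.cos_three_mul, Real.cos_arccos h1 h2]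

/-- `π/3 < arccos (81/200)`, `arccos (1/4) < π/2`, `arccos (81/200) ≤ arccos (1/4)`. [folklore] -/
theorem T_bounds : π / 3 < Real.arccos (81 / 200) ∧ Real.arccos (1 / 4) < π / 2 ∧
    Real.arccos (81 / 200) ≤ Real.arccos (1 / 4) := by
  refine ⟨?_, ?_, Real.arccos_le_arccos (by norm_num)⟩
  · rw [← Real.arccos_cos (x := π / 3) (by positivity) (by linarith [Real.pi_pos]),
      Real.cos_pi_div_three]
    exact Real.arccos_lt_arccos (by norm_num) (by norm_num) (by norm_num)
  · rw [← Real.arccos_zero]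
    exact Real.arccos_lt_arccos (by norm_num) (by norm_num) (by norm_num)

/-- `arccos (1/4) ≤ 1.32` and `1.15 ≤ arccos (81/200)`. [folklore] -/
private theorem T_brackets : Real.arccos (1 / 4) ≤ 33 / 25 ∧ 23 / 20 ≤ Real.arccos (81 / 200) := by
  constructor
  · apply (arccos_lt_of_cos_lt (by norm_num) (by linarith [pi_gt_three]) (by norm_num) ?_).le
    refine lt_of_le_of_lt (cos_upper_quarter (by norm_num) (by norm_num)) ?_
    norm_num
  · apply (lt_arccos_of_lt_cos (by norm_num) (by linarith [pi_gt_three]) (by norm_num) ?_).le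
    refine lt_of_lt_of_le ?_ (cos_lower_quarter (by norm_num) (by norm_num))
    norm_num

/-- The closing angle at a vertex exceeds `2 TM − Tm`: numerically,
`(c_far − c₁²)/(1 − c₀²) < cos 1.53` and `2 · 1.32 − 1.15 < 1.53`. [folklore] -/
private theorem closing_bracket :
    (1233 / 5202 - (2201 / 4802 : ℝ) ^ 2) / (19215203 / 27060804) < Real.cos (153 / 100) := by
  refine lt_of_lt_of_le ?_ (cos_lower_quarter (by norm_num) (by norm_num))
  norm_num

/-- The band excess constant `E₀ = 0.498`: `1 − cos E₀ ≤ F(c₀, c₀, c₀)`. [folklore] -/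
private theorem band_bracket :
    1 - Real.cos (249 / 500) ≤ eulerF (2801 / 5202) (2801 / 5202) (2801 / 5202) := by
  have h := cos_lower_quarter (x := 249 / 500) (by norm_num) (by norm_num)
  have : (62282910004 / 512576216027 : ℝ) ≤ eulerF (2801 / 5202) (2801 / 5202) (2801 / 5202) := by
    norm_num [eulerF, eulerGram]
  refine le_trans ?_ this
  refine le_trans (sub_le_sub_left h 1) ?_
  norm_num

/-- Euler's function at the eight corners of the box `[c₁, c₀]³` is at least its value at
`(c₀, c₀, c₀)` (the smallest bonded triangle has the smallest area). [folklore] -/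
private theorem band_corners : ∀ x' ∈ ({2201 / 4802, 2801 / 5202} : Set ℝ),
    ∀ y' ∈ ({2201 / 4802, 2801 / 5202} : Set ℝ), ∀ z' ∈ ({2201 / 4802, 2801 / 5202} : Set ℝ),
    (62282910004 / 512576216027 : ℝ) ≤ eulerF x' y' z' := by
  intro x' hx' y' hy' z' hz'
  simp only [Set.mem_insert_iff, Set.mem_singleton_iff] at hx' hy' hz'
  rcases hx' with rfl | rfl <;> rcases hy' with rfl | rfl <;> rcases hz' with rfl | rfl <;>
    norm_num [eulerF, eulerGram]

/-- The ear constants: `1 − cos 0.428 ≤ φ(21/25)` and `1 − cos 0.262 ≤ φ(w_hi)`,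
`w_hi = 1898559/2000000 = 3 · (81/200) − 4 · (81/200)³`. [folklore] -/
private theorem ear_brackets :
    1 - Real.cos (107 / 250) ≤ 2 * (2401 / 8003) ^ 2 * (1 - (21 / 25 : ℝ) ^ 2) /
      (1 - 2 * (2401 / 8003) * (21 / 25) + (2401 / 8003) ^ 2) ∧
    1 - Real.cos (131 / 500) ≤ 2 * (2401 / 8003) ^ 2 * (1 - (1898559 / 2000000 : ℝ) ^ 2) /
      (1 - 2 * (2401 / 8003) * (1898559 / 2000000) + (2401 / 8003) ^ 2) := by
  constructor
  · have h := cos_lower_quarter (x := 107 / 250) (by norm_num) (by norm_num)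
    refine le_trans (sub_le_sub_left h 1) ?_
    norm_num
  · have h := cos_lower_quarter (x := 131 / 500) (by norm_num) (by norm_num)
    refine le_trans (sub_le_sub_left h 1) ?_
    norm_num

/-- The bound `Y_L` on the base cosines of the ears (apex cosine `≤ −11/16`). -/
local notation "YL" => ((2801 / 5202 : ℝ) ^ 2 - 19215203 / 27060804 * (11 / 16))

/-- The bound `Y_M` on the base cosines of the ears with apex cosine `≤ −21/25`. -/
local notation "YM" => ((2801 / 5202 : ℝ) ^ 2 - 19215203 / 27060804 * (21 / 25))

/-- The six inner-angle constants. [folklore] -/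
private theorem iota_brackets :
    (YL - YL * YL) / (1 - YL ^ 2) ≤ Real.cos (91 / 50) ∧
    (YM - YL * YL) / (1 - YL ^ 2) ≤ Real.cos (969 / 500) ∧
    (YL - YL * YM) / (1 - YL ^ 2) ≤ Real.cos (1843 / 1000) ∧
    (YL - YM * YM) / (1 - YL ^ 2) ≤ Real.cos (1879 / 1000) ∧
    (YM - YL * YM) / (1 - YL ^ 2) ≤ Real.cos (981 / 500) ∧
    (YM - YM * YM) / (1 - YL ^ 2) ≤ Real.cos 2 := by
  refine ⟨?_, ?_, ?_, ?_, ?_, ?_⟩ <;>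
    refine le_trans ?_ (cos_lower_quarter (by norm_num) (by norm_num)) <;>
    norm_num


/-! ### Part 5. The ring of a labelled antiprism -/

/-- An acute angle from a positive inner product. [folklore] -/
private theorem angle_lt_pi_div_two_of_inner_pos {x y : E3} (h : 0 < ⟪x, y⟫) :
    angle x y < π / 2 := by
  by_contra hle
  have hcos : Real.cos (angle x y) ≤ 0 :=
    Real.cos_nonpos_of_pi_div_two_le_of_le (le_of_not_gt hle) (by linarith [angle_le_pi x y])
  have := cos_angle_mul_norm_mul_norm x y
  have hn : 0 ≤ ‖x‖ * ‖y‖ := by positivity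
  nlinarith [mul_nonpos_of_nonpos_of_nonneg hcos hn]

/-- An obtuse angle from a negative inner product. [folklore] -/
private theorem pi_div_two_lt_angle_of_inner_neg {x y : E3} (h : ⟪x, y⟫ < 0) :
    π / 2 < angle x y := by
  by_contra hle
  have hcos : 0 ≤ Real.cos (angle x y) :=
    Real.cos_nonneg_of_neg_pi_div_two_le_of_le (by linarith [angle_nonneg x y, Real.pi_pos])
      (le_of_not_gt hle)
  have := cos_angle_mul_norm_mul_norm x y
  have hn : 0 ≤ ‖x‖ * ‖y‖ := by positivity
  nlinarith [mul_nonneg hcos hn]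

/-- `cos` is increasing on `[π, 2π]`. [folklore] -/
private theorem cos_le_cos_of_pi_le {x x' : ℝ} (hx : π ≤ x) (hxx' : x ≤ x') (hx' : x' ≤ 2 * π) :
    Real.cos x ≤ Real.cos x' := by
  rw [← Real.cos_two_pi_sub x, ← Real.cos_two_pi_sub x']
  exact Real.cos_le_cos_of_nonneg_of_le_pi (by linarith) (by linarith) (by linarith)

/-- The product of the two projection lengths of the legs of an ear lies in `[1 − c₀², 1]`. [folklore] -/
private theorem legs_prod_window {a b c : E3} (ha : ‖a‖ = 1) (hb : ‖b‖ = 1) (hc : ‖c‖ = 1)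
    (hab : 2201 / 4802 ≤ ⟪a, b⟫ ∧ ⟪a, b⟫ ≤ 2801 / 5202)
    (hac : 2201 / 4802 ≤ ⟪a, c⟫ ∧ ⟪a, c⟫ ≤ 2801 / 5202) :
    19215203 / 27060804 ≤ ‖perpTo a b‖ * ‖perpTo a c‖ ∧ ‖perpTo a b‖ * ‖perpTo a c‖ ≤ 1 := by
  have hq2 : ‖perpTo a b‖ ^ 2 = 1 - ⟪a, b⟫ ^ 2 := norm_perpTo_sq_of_norm_eq_one ha hb
  have hq2' : ‖perpTo a c‖ ^ 2 = 1 - ⟪a, c⟫ ^ 2 := norm_perpTo_sq_of_norm_eq_one ha hc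
  have h1 : (19215203 / 27060804 : ℝ) ≤ ‖perpTo a b‖ ^ 2 := by rw [hq2]; nlinarith [hab.1, hab.2]
  have h2 : (19215203 / 27060804 : ℝ) ≤ ‖perpTo a c‖ ^ 2 := by rw [hq2']; nlinarith [hac.1, hac.2]
  have h1' : ‖perpTo a b‖ ^ 2 ≤ 1 := by rw [hq2]; nlinarith
  have h2' : ‖perpTo a c‖ ^ 2 ≤ 1 := by rw [hq2']; nlinarith
  constructor
  · have h3 : (19215203 / 27060804 : ℝ) ^ 2 ≤ (‖perpTo a b‖ * ‖perpTo a c‖) ^ 2 := by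
      rw [mul_pow, pow_two]
      exact mul_le_mul h1 h2 (by norm_num) (by positivity)
    exact (pow_le_pow_iff_left₀ (by norm_num) (by positivity) two_ne_zero).1 h3
  · have h3 : (‖perpTo a b‖ * ‖perpTo a c‖) ^ 2 ≤ 1 ^ 2 := by
      rw [mul_pow, one_pow]
      calc ‖perpTo a b‖ ^ 2 * ‖perpTo a c‖ ^ 2 ≤ 1 * 1 :=
            mul_le_mul h1' h2' (by positivity) (by norm_num)
        _ = 1 := by ring
    exact (pow_le_pow_iff_left₀ (by positivity) (by norm_num) two_ne_zero).1 h3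

/-- **The base cosine of an ear**: with legs in `[c₁, c₀]` and apex cosine `≤ −w` (`w ≥ 0`),
the base has cosine `⟪b, c⟫ ≤ c₀² − (1 − c₀²) w`; and always `⟪b, c⟫ > −1`. [folklore] -/
private theorem base_cos_le {a b c : E3} (ha : ‖a‖ = 1) (hb : ‖b‖ = 1) (hc : ‖c‖ = 1)
    (hab : 2201 / 4802 ≤ ⟪a, b⟫ ∧ ⟪a, b⟫ ≤ 2801 / 5202)
    (hac : 2201 / 4802 ≤ ⟪a, c⟫ ∧ ⟪a, c⟫ ≤ 2801 / 5202) {w : ℝ} (hw : 0 ≤ w)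
    (hκ : Real.cos (angle (perpTo a b) (perpTo a c)) ≤ -w) :
    ⟪b, c⟫ ≤ (2801 / 5202) ^ 2 - 19215203 / 27060804 * w ∧ -1 < ⟪b, c⟫ := by
  obtain ⟨hQ0, hQ1⟩ := legs_prod_window ha hb hc hab hac
  have hcos := cos_angle_perpTo_mul ha b c
  set Q := ‖perpTo a b‖ * ‖perpTo a c‖ with hQ
  set κ := Real.cos (angle (perpTo a b) (perpTo a c))
  have hκ1 : -1 ≤ κ := Real.neg_one_le_cos _
  constructor
  · have h1 : κ * Q ≤ -w * Q := mul_le_mul_of_nonneg_right hκ (by positivity)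
    have h2 : -w * Q ≤ -w * (19215203 / 27060804) := by nlinarith
    have h3 : ⟪a, b⟫ * ⟪a, c⟫ ≤ (2801 / 5202) * (2801 / 5202) :=
      mul_le_mul hab.2 hac.2 (by linarith [hac.1]) (by norm_num)
    nlinarith [hcos, h1, h2, h3]
  · have h1 : -1 * Q ≤ κ * Q := mul_le_mul_of_nonneg_right hκ1 (by positivity)
    have h3 : 0 < ⟪a, b⟫ * ⟪a, c⟫ := mul_pos (by linarith [hab.1]) (by linarith [hac.1])
    nlinarith [hcos, h1, hQ1]

/-- **The closing angle is large**: at a shell vertex `v` (unit) with bonded `a, b`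
(`⟪v, a⟫, ⟪v, b⟫ ∈ [c₁, c₀]`) and the far pair `⟪a, b⟫ ≤ c_far`, the angle
`∠(p_v b, p_v a)` exceeds `1.53 > 2 · 1.32 − 1.15`. [folklore] -/
private theorem closing_angle_gt {v a b : E3} (hv : ‖v‖ = 1) (ha : ‖a‖ = 1) (hb : ‖b‖ = 1)
    (hva : 2201 / 4802 ≤ ⟪v, a⟫ ∧ ⟪v, a⟫ ≤ 2801 / 5202)
    (hvb : 2201 / 4802 ≤ ⟪v, b⟫ ∧ ⟪v, b⟫ ≤ 2801 / 5202) (hab : ⟪a, b⟫ ≤ 1233 / 5202) :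
    153 / 100 < angle (perpTo v b) (perpTo v a) := by
  obtain ⟨hQ0, -⟩ := legs_prod_window hv hb ha hvb hva
  have hcos := cos_angle_perpTo_mul hv b a
  rw [real_inner_comm b a] at hab
  by_contra hle
  have hle' : angle (perpTo v b) (perpTo v a) ≤ 153 / 100 := le_of_not_gt hle
  have hc : Real.cos (153 / 100) ≤ Real.cos (angle (perpTo v b) (perpTo v a)) :=
    Real.cos_le_cos_of_nonneg_of_le_pi (angle_nonneg _ _) (by linarith [pi_gt_three]) hle'
  have hnum := closing_bracket
  have hpos : 0 < Real.cos (153 / 100) := lt_trans (by norm_num) hnum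
  have h1 : Real.cos (153 / 100) * (19215203 / 27060804) ≤
      Real.cos (angle (perpTo v b) (perpTo v a)) * (‖perpTo v b‖ * ‖perpTo v a‖) :=
    mul_le_mul hc hQ0 (by norm_num) (hpos.le.trans hc)
  have h2 : ⟪v, b⟫ * ⟪v, a⟫ ≥ 2201 / 4802 * (2201 / 4802) :=
    mul_le_mul hvb.1 hva.1 (by norm_num) (by linarith [hvb.1])
  have h3 : (1233 / 5202 - (2201 / 4802 : ℝ) ^ 2) < Real.cos (153 / 100) * (19215203 / 27060804) := by
    rw [div_lt_iff₀ (by norm_num)] at hnum; exact hnum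
  nlinarith [hcos, h1, h2, h3]

/-- The apex cosine of a hexagon corner `C = 2π − S`, `S ∈ [3 Tm, 3 TM]`, lies in
`[−w_hi, −11/16]` (`cos 3TM = −11/16`, `cos 3Tm = −w_hi`). [folklore] -/
private theorem apex_cos_window {S : ℝ} (h1 : 3 * Real.arccos (81 / 200) ≤ S)
    (h2 : S ≤ 3 * Real.arccos (1 / 4)) :
    -(1898559 / 2000000) ≤ Real.cos (2 * π - S) ∧ Real.cos (2 * π - S) ≤ -(11 / 16) := by
  obtain ⟨hTm, hTM, -⟩ := T_bounds
  rw [Real.cos_two_pi_sub]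
  have e1 : Real.cos (3 * Real.arccos (81 / 200)) = -(1898559 / 2000000) := by
    rw [cos_three_arccos (by norm_num) (by norm_num)]; norm_num
  have e2 : Real.cos (3 * Real.arccos (1 / 4)) = -(11 / 16) := by
    rw [cos_three_arccos (by norm_num) (by norm_num)]; norm_num
  constructor
  · rw [← e1]
    exact cos_le_cos_of_pi_le (by linarith) h1 (by linarith)
  · rw [← e2]
    exact cos_le_cos_of_pi_le (by linarith) h2 (by linarith)

/-- A cosine in the bond window has square `< 1`. [folklore] -/
theorem sq_lt_one_of_window {x : ℝ} (h : 2201 / 4802 ≤ x ∧ x ≤ 2801 / 5202) :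
    x ^ 2 < 1 := by
  obtain ⟨h1, h2⟩ := h; nlinarith

/-- A number in `(−1, 0)` has square `< 1`. [folklore] -/
private theorem sq_lt_one_of_neg {x : ℝ} (h1 : -1 < x) (h2 : x < 0) : x ^ 2 < 1 := by
  nlinarith

/-- **An even ring vertex.**  `v` unit with the four bonded directions `a, w, w', b` in
positive turn order (first turn positively oriented), corners in `[Tm, TM]`, `a b` far: the
hexagon corner `C = ∠(p b, p a)` equals `2π − T₁ − T₂ − T₃`, the closing turn `b → a` is
positively oriented, and `cos C ∈ [−w_hi, −11/16]`. [folklore] -/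
private theorem even_vertex {v a w w' b : E3} (hv : ‖v‖ = 1) (ha : ‖a‖ = 1) (hw : ‖w‖ = 1)
    (hw' : ‖w'‖ = 1) (hb : ‖b‖ = 1)
    (hva : 2201 / 4802 ≤ ⟪v, a⟫ ∧ ⟪v, a⟫ ≤ 2801 / 5202)
    (hvw : 2201 / 4802 ≤ ⟪v, w⟫ ∧ ⟪v, w⟫ ≤ 2801 / 5202)
    (hvw' : 2201 / 4802 ≤ ⟪v, w'⟫ ∧ ⟪v, w'⟫ ≤ 2801 / 5202)
    (hvb : 2201 / 4802 ≤ ⟪v, b⟫ ∧ ⟪v, b⟫ ≤ 2801 / 5202) (hab : ⟪a, b⟫ ≤ 1233 / 5202)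
    (h1 : Real.arccos (81 / 200) ≤ angle (perpTo v a) (perpTo v w) ∧
      angle (perpTo v a) (perpTo v w) ≤ Real.arccos (1 / 4))
    (h2 : Real.arccos (81 / 200) ≤ angle (perpTo v w) (perpTo v w') ∧
      angle (perpTo v w) (perpTo v w') ≤ Real.arccos (1 / 4))
    (h3 : Real.arccos (81 / 200) ≤ angle (perpTo v w') (perpTo v b) ∧
      angle (perpTo v w') (perpTo v b) ≤ Real.arccos (1 / 4))
    (hs1 : 0 < orient3 v a w) :
    angle (perpTo v b) (perpTo v a) = 2 * π - (angle (perpTo v a) (perpTo v w) +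
      angle (perpTo v w) (perpTo v w') + angle (perpTo v w') (perpTo v b)) ∧
    0 < orient3 v b a ∧
    -(1898559 / 2000000) ≤ Real.cos (angle (perpTo v b) (perpTo v a)) ∧
      Real.cos (angle (perpTo v b) (perpTo v a)) ≤ -(11 / 16) := by
  obtain ⟨hTm, hTM, -⟩ := T_bounds
  obtain ⟨hTM', hTm'⟩ := T_brackets
  have pa := perpTo_ne_zero_of_unit hv ha (sq_lt_one_of_window hva)
  have pw := perpTo_ne_zero_of_unit hv hw (sq_lt_one_of_window hvw)
  have pw' := perpTo_ne_zero_of_unit hv hw' (sq_lt_one_of_window hvw')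
  have pb := perpTo_ne_zero_of_unit hv hb (sq_lt_one_of_window hvb)
  have hθ := closing_angle_gt hv ha hb hva hvb hab
  obtain ⟨s2, s3, s4, hC⟩ := vertex4_pos hv pa pw pw' pb hTm hTM h1 h2 h3 (by linarith) hs1
  refine ⟨hC, s4, ?_⟩
  rw [hC]
  exact apex_cos_window (by linarith [h1.1, h2.1, h3.1]) (by linarith [h1.2, h2.2, h3.2])

/-- **An odd ring vertex.**  `v` unit with bonded `a, w, w', b` in positive turn order and the
two further ring directions `c` (after `b`) and `d` (before `a`), with `⟪v, c⟫, ⟪v, d⟫, ⟪c, d⟫`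
negative (short diagonals) and `⟪b, c⟫, ⟪d, a⟫` positive (ring bonds): then
`T₁ + T₂ + T₃ + ∠(p b, p c) + ∠(p c, p d) + ∠(p d, p a) = 2π`. [folklore] -/
private theorem odd_vertex {v a w w' b c d : E3} (hv : ‖v‖ = 1) (ha : ‖a‖ = 1) (hw : ‖w‖ = 1)
    (hw' : ‖w'‖ = 1) (hb : ‖b‖ = 1) (hc : ‖c‖ = 1) (hd : ‖d‖ = 1)
    (hva : 2201 / 4802 ≤ ⟪v, a⟫ ∧ ⟪v, a⟫ ≤ 2801 / 5202)
    (hvw : 2201 / 4802 ≤ ⟪v, w⟫ ∧ ⟪v, w⟫ ≤ 2801 / 5202)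
    (hvw' : 2201 / 4802 ≤ ⟪v, w'⟫ ∧ ⟪v, w'⟫ ≤ 2801 / 5202)
    (hvb : 2201 / 4802 ≤ ⟪v, b⟫ ∧ ⟪v, b⟫ ≤ 2801 / 5202)
    (hvc : ⟪v, c⟫ < 0) (hvc1 : -1 < ⟪v, c⟫) (hvd : ⟪v, d⟫ < 0) (hvd1 : -1 < ⟪v, d⟫)
    (hcd : ⟪c, d⟫ < 0) (hbc : 0 < ⟪b, c⟫) (hda : 0 < ⟪d, a⟫)
    (h1 : Real.arccos (81 / 200) ≤ angle (perpTo v a) (perpTo v w) ∧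
      angle (perpTo v a) (perpTo v w) ≤ Real.arccos (1 / 4))
    (h2 : Real.arccos (81 / 200) ≤ angle (perpTo v w) (perpTo v w') ∧
      angle (perpTo v w) (perpTo v w') ≤ Real.arccos (1 / 4))
    (h3 : Real.arccos (81 / 200) ≤ angle (perpTo v w') (perpTo v b) ∧
      angle (perpTo v w') (perpTo v b) ≤ Real.arccos (1 / 4))
    (hs1 : 0 < orient3 v a w) (hs2 : 0 < orient3 v w w') (hs3 : 0 < orient3 v w' b)
    (hs4 : 0 < orient3 v b c) (hs6 : 0 < orient3 v d a) :
    angle (perpTo v a) (perpTo v w) + angle (perpTo v w) (perpTo v w') +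
      angle (perpTo v w') (perpTo v b) + angle (perpTo v b) (perpTo v c) +
      angle (perpTo v c) (perpTo v d) + angle (perpTo v a) (perpTo v d) = 2 * π := by
  obtain ⟨hTm, hTM, -⟩ := T_bounds
  rw [angle_comm (perpTo v a) (perpTo v d)]
  have pa := perpTo_ne_zero_of_unit hv ha (sq_lt_one_of_window hva)
  have pw := perpTo_ne_zero_of_unit hv hw (sq_lt_one_of_window hvw)
  have pw' := perpTo_ne_zero_of_unit hv hw' (sq_lt_one_of_window hvw')
  have pb := perpTo_ne_zero_of_unit hv hb (sq_lt_one_of_window hvb)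
  have pc := perpTo_ne_zero_of_unit hv hc (sq_lt_one_of_neg hvc1 hvc)
  have pd := perpTo_ne_zero_of_unit hv hd (sq_lt_one_of_neg hvd1 hvd)
  have hβ : angle (perpTo v b) (perpTo v c) < π / 2 := by
    apply angle_lt_pi_div_two_of_inner_pos
    rw [inner_perpTo_perpTo_of_norm_eq_one hv]
    have := mul_neg_of_pos_of_neg (by linarith [hvb.1] : 0 < ⟪v, b⟫) hvc
    linarith
  have hβ' : angle (perpTo v d) (perpTo v a) < π / 2 := by
    apply angle_lt_pi_div_two_of_inner_pos
    rw [inner_perpTo_perpTo_of_norm_eq_one hv]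
    have := mul_neg_of_neg_of_pos hvd (by linarith [hva.1] : 0 < ⟪v, a⟫)
    linarith
  have hι : π / 2 < angle (perpTo v c) (perpTo v d) := by
    apply pi_div_two_lt_angle_of_inner_neg
    rw [inner_perpTo_perpTo_of_norm_eq_one hv]
    linarith [mul_pos_of_neg_of_neg hvc hvd]
  exact vertex6 hv pa pw pw' pb pc pd hTm hTM h1 h2 h3 hs1 hs2 hs3 hs4 hs6 hβ hβ' hι


/-- The two boxes for an apex cosine: `false` ↔ `−cos C ∈ [11/16, 21/25]`,
`true` ↔ `−cos C ∈ [21/25, w_hi]`; `Yv` is the corresponding bound on the base cosine. -/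
local notation "Yv(" b ")" => (ite (b = true) YM YL : ℝ)

/-- The ear excess constant of a box. -/
local notation "eC(" b ")" => (ite (b = true) (131 / 500) (107 / 250) : ℝ)

/-- The inner-angle constant for (box of the opposite side | boxes of the adjacent sides). -/
local notation "iotaC(" o ", " a ", " b ")" =>
  (ite (o = true) (ite ((a && b) = true) 2 (ite ((a || b) = true) (981 / 500) (969 / 500)))
    (ite ((a && b) = true) (1879 / 1000) (ite ((a || b) = true) (1843 / 1000) (91 / 50))) : ℝ)

/-- Both base-cosine bounds are at most `Y_L`. [folklore] -/
private theorem Yv_le_YL (β : Bool) : Yv(β) ≤ YL := by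
  cases β <;> norm_num

/-- `Y_L < 0`. [folklore] -/
private theorem YL_neg : YL < 0 := by norm_num

/-- The eight inner-angle brackets `K ≤ cos ι_c`. [folklore] -/
private theorem iotaC_bracket (o a b : Bool) :
    (Yv(o) - Yv(a) * Yv(b)) / (1 - YL ^ 2) ≤ Real.cos (iotaC(o, a, b)) := by
  obtain ⟨k1, k2, k3, k4, k5, k6⟩ := iota_brackets
  norm_num at k1 k2 k3 k4 k5 k6
  cases o <;> cases a <;> cases b <;> norm_num <;>
    first | exact k1 | exact k2 | exact k3 | exact k4 | exact k5 | exact k6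

/-- The inner-angle constants lie in `[0, π]`. [folklore] -/
private theorem iotaC_mem (o a b : Bool) : 0 ≤ iotaC(o, a, b) ∧ iotaC(o, a, b) ≤ π := by
  have := pi_gt_three
  cases o <;> cases a <;> cases b <;> norm_num <;> linarith

/-- **The box totals**: in each of the eight boxes the three ear constants and the three
inner-angle constants add up to at least `B = 3371/500`. [folklore] -/
private theorem box_total (b0 b2 b4 : Bool) :
    3371 / 500 ≤ eC(b0) + eC(b2) + eC(b4) + iotaC(b4, b0, b2) + iotaC(b0, b2, b4) +
      iotaC(b2, b4, b0) := by
  cases b0 <;> cases b2 <;> cases b4 <;> norm_num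

/-- `t ≤ arccos K` from `K ≤ cos t`, `t ∈ [0, π]`. [folklore] -/
private theorem le_arccos_of_le_cos {t K : ℝ} (h0 : 0 ≤ t) (hπ : t ≤ π) (h : K ≤ Real.cos t) :
    t ≤ Real.arccos K := by
  rw [← Real.arccos_cos h0 hπ]; exact Real.arccos_le_arccos h

/-- **The ear at an even ring vertex, boxed.**  Apex `a` (unit) with legs to `b, c` in the
bond window, positively oriented, apex cosine in `[−w_hi, −11/16]`: the base cosine is
`≤ Y_L` and `> −1`, and in its box `β` it is `≤ Yv β` while the excess is `≥ eC β`. [folklore] -/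
private theorem ear_box {a b c : E3} (ha : ‖a‖ = 1) (hb : ‖b‖ = 1) (hc : ‖c‖ = 1)
    (hab : 2201 / 4802 ≤ ⟪a, b⟫ ∧ ⟪a, b⟫ ≤ 2801 / 5202)
    (hac : 2201 / 4802 ≤ ⟪a, c⟫ ∧ ⟪a, c⟫ ≤ 2801 / 5202) (hor : 0 < orient3 a b c)
    (hκ1 : -(1898559 / 2000000) ≤ Real.cos (angle (perpTo a b) (perpTo a c)))
    (hκ2 : Real.cos (angle (perpTo a b) (perpTo a c)) ≤ -(11 / 16)) :
    (⟪b, c⟫ ≤ YL ∧ -1 < ⟪b, c⟫) ∧ ∃ β : Bool, ⟪b, c⟫ ≤ Yv(β) ∧ eC(β) ≤ sphExcess a b c := by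
  have hli := linearIndependent_of_orient3_ne_zero hor.ne'
  obtain ⟨e1, e2⟩ := ear_brackets
  have hπ := pi_gt_three
  refine ⟨?_, ?_⟩
  · have := base_cos_le ha hb hc hab hac (by norm_num : (0 : ℝ) ≤ 11 / 16) hκ2
    exact ⟨this.1, this.2⟩
  rcases le_or_gt (Real.cos (angle (perpTo a b) (perpTo a c))) (-(21 / 25)) with h | h
  · refine ⟨true, ?_, ?_⟩
    · have := base_cos_le ha hb hc hab hac (by norm_num : (0 : ℝ) ≤ 21 / 25) h
      rw [if_pos rfl]; exact this.1
    · rw [if_pos rfl]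
      exact ear_excess ha hb hc hab hac hli (by norm_num) (by norm_num) hκ1 (by linarith)
        (by linarith) e2
  · refine ⟨false, ?_, ?_⟩
    · have := base_cos_le ha hb hc hab hac (by norm_num : (0 : ℝ) ≤ 11 / 16) hκ2
      rw [if_neg Bool.false_ne_true]; exact this.1
    · rw [if_neg Bool.false_ne_true]
      exact ear_excess ha hb hc hab hac hli (by norm_num) (by norm_num) h.le (by linarith)
        (by linarith) e1

/-- An inner angle in terms of the boxes. [folklore] -/
private theorem iota_box {v x y : E3} (hv : ‖v‖ = 1) (hx : ‖x‖ = 1) (hy : ‖y‖ = 1)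
    {o a b : Bool} (hxy : ⟪x, y⟫ ≤ Yv(o)) (hvx : ⟪v, x⟫ ≤ Yv(a)) (hvy : ⟪v, y⟫ ≤ Yv(b))
    (h1x : -1 < ⟪v, x⟫) (h1y : -1 < ⟪v, y⟫) :
    iotaC(o, a, b) ≤ angle (perpTo v x) (perpTo v y) := by
  have key := inner_angle_bound hv hx hy YL_neg (Yv_le_YL o) (Yv_le_YL a) (Yv_le_YL b) hxy hvx
    hvy h1x h1y
  exact (le_arccos_of_le_cos (iotaC_mem o a b).1 (iotaC_mem o a b).2 (iotaC_bracket o a b)).trans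
    key

/-- **The angle budget of one ring.**  For a ring `X₀ … X₅` with partner ring `Y` (all unit
vectors) in the pattern of ring `A` of the antiprism — bonds `Xᵢ Xᵢ₊₁`, `Xᵢ Yᵢ`, `Xᵢ₊₁ Yᵢ`, far
pairs `Xᵢ Xᵢ₊₂`, at each `Xᵢ` the turns `Xᵢ₊₁ → Yᵢ → Yᵢ₋₁ → Xᵢ₋₁` with corners in `[Tm, TM]`
and the band triangles positively oriented — the eighteen corners at the ring add up to at most
`9π − B`. [folklore] -/
private theorem ring_budget (X Y : Fin 6 → E3) (hX : ∀ i, ‖X i‖ = 1) (hY : ∀ i, ‖Y i‖ = 1)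
    (hXX : ∀ i j, j = i + 1 → 2201 / 4802 ≤ ⟪X i, X j⟫ ∧ ⟪X i, X j⟫ ≤ 2801 / 5202)
    (hXY : ∀ i, 2201 / 4802 ≤ ⟪X i, Y i⟫ ∧ ⟪X i, Y i⟫ ≤ 2801 / 5202)
    (hXY' : ∀ i j, j = i + 1 → 2201 / 4802 ≤ ⟪X j, Y i⟫ ∧ ⟪X j, Y i⟫ ≤ 2801 / 5202)
    (hfar : ∀ i j, j = i + 2 → ⟪X j, X i⟫ ≤ 1233 / 5202)
    (hT1 : ∀ i j, j = i + 1 →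
      Real.arccos (81 / 200) ≤ angle (perpTo (X i) (X j)) (perpTo (X i) (Y i)) ∧
      angle (perpTo (X i) (X j)) (perpTo (X i) (Y i)) ≤ Real.arccos (1 / 4))
    (hT2 : ∀ i j, j = i + 1 →
      Real.arccos (81 / 200) ≤ angle (perpTo (X j) (Y j)) (perpTo (X j) (Y i)) ∧
      angle (perpTo (X j) (Y j)) (perpTo (X j) (Y i)) ≤ Real.arccos (1 / 4))
    (hT3 : ∀ i j, j = i + 1 →
      Real.arccos (81 / 200) ≤ angle (perpTo (X j) (Y i)) (perpTo (X j) (X i)) ∧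
      angle (perpTo (X j) (Y i)) (perpTo (X j) (X i)) ≤ Real.arccos (1 / 4))
    (hO1 : ∀ i j, j = i + 1 → 0 < orient3 (X i) (X j) (Y i))
    (hO2 : ∀ i j, j = i + 1 → 0 < orient3 (X j) (Y j) (Y i)) :
    ∑ i, (angle (perpTo (X i) (X (i + 1))) (perpTo (X i) (Y i)) +
      angle (perpTo (X (i + 1)) (Y (i + 1))) (perpTo (X (i + 1)) (Y i)) +
      angle (perpTo (X (i + 1)) (Y i)) (perpTo (X (i + 1)) (X i))) ≤ 9 * π - 3371 / 500 := by
  -- orientation of the third turn at each vertex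
  have hO3 : ∀ i j, j = i + 1 → 0 < orient3 (X j) (Y i) (X i) := fun i j h => by
    rw [orient3_cyclic, orient3_cyclic]; exact hO1 i j h
  -- symmetric bond windows
  have hXX' : ∀ i j, j = i + 1 → 2201 / 4802 ≤ ⟪X j, X i⟫ ∧ ⟪X j, X i⟫ ≤ 2801 / 5202 :=
    fun i j h => by rw [real_inner_comm]; exact hXX i j h
  -- the even vertices
  obtain ⟨C0, s0, k0⟩ := even_vertex (hX 0) (hX 1) (hY 0) (hY 5) (hX 5) (hXX 0 1 rfl) (hXY 0)
    (hXY' 5 0 rfl) (hXX' 5 0 rfl) (hfar 5 1 rfl) (hT1 0 1 rfl) (hT2 5 0 rfl) (hT3 5 0 rfl)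
    (hO1 0 1 rfl)
  obtain ⟨C2, s2, k2⟩ := even_vertex (hX 2) (hX 3) (hY 2) (hY 1) (hX 1) (hXX 2 3 rfl) (hXY 2)
    (hXY' 1 2 rfl) (hXX' 1 2 rfl) (hfar 1 3 rfl) (hT1 2 3 rfl) (hT2 1 2 rfl) (hT3 1 2 rfl)
    (hO1 2 3 rfl)
  obtain ⟨C4, s4, k4⟩ := even_vertex (hX 4) (hX 5) (hY 4) (hY 3) (hX 3) (hXX 4 5 rfl) (hXY 4)
    (hXY' 3 4 rfl) (hXX' 3 4 rfl) (hfar 3 5 rfl) (hT1 4 5 rfl) (hT2 3 4 rfl) (hT3 3 4 rfl)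
    (hO1 4 5 rfl)
  -- the ears (apex `X k`, then `X (k-1)`, `X (k+1)`)
  obtain ⟨⟨yL0, ym0⟩, b0, hy0, hE0⟩ := ear_box (hX 0) (hX 5) (hX 1) (hXX' 5 0 rfl) (hXX 0 1 rfl)
    s0 k0.1 k0.2
  obtain ⟨⟨yL2, ym2⟩, b2, hy2, hE2⟩ := ear_box (hX 2) (hX 1) (hX 3) (hXX' 1 2 rfl) (hXX 2 3 rfl)
    s2 k2.1 k2.2
  obtain ⟨⟨yL4, ym4⟩, b4, hy4, hE4⟩ := ear_box (hX 4) (hX 3) (hX 5) (hXX' 3 4 rfl) (hXX 4 5 rfl)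
    s4 k4.1 k4.2
  have yneg : ∀ {x : ℝ}, x ≤ YL → x < 0 := fun h => h.trans_lt YL_neg
  -- the odd vertices
  have O1 := odd_vertex (v := X 1) (a := X 2) (w := Y 1) (w' := Y 0) (b := X 0) (c := X 5)
    (d := X 3) (hX 1) (hX 2) (hY 1) (hY 0) (hX 0) (hX 5) (hX 3) (hXX 1 2 rfl) (hXY 1)
    (hXY' 0 1 rfl) (hXX' 0 1 rfl)
    (by rw [real_inner_comm]; exact yneg yL0) (by rw [real_inner_comm]; exact ym0)
    (yneg yL2) ym2 (by rw [real_inner_comm]; exact yneg yL4)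
    (by linarith [(hXX' 5 0 rfl).1]) (by linarith [(hXX' 2 3 rfl).1])
    (hT1 1 2 rfl) (hT2 0 1 rfl) (hT3 0 1 rfl) (hO1 1 2 rfl) (hO2 0 1 rfl) (hO3 0 1 rfl)
    (by rw [orient3_cyclic]; exact s0) (by rw [orient3_cyclic, orient3_cyclic]; exact s2)
  have O3 := odd_vertex (v := X 3) (a := X 4) (w := Y 3) (w' := Y 2) (b := X 2) (c := X 1)
    (d := X 5) (hX 3) (hX 4) (hY 3) (hY 2) (hX 2) (hX 1) (hX 5) (hXX 3 4 rfl) (hXY 3)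
    (hXY' 2 3 rfl) (hXX' 2 3 rfl)
    (by rw [real_inner_comm]; exact yneg yL2) (by rw [real_inner_comm]; exact ym2)
    (yneg yL4) ym4 (by rw [real_inner_comm]; exact yneg yL0)
    (by linarith [(hXX' 1 2 rfl).1]) (by linarith [(hXX' 4 5 rfl).1])
    (hT1 3 4 rfl) (hT2 2 3 rfl) (hT3 2 3 rfl) (hO1 3 4 rfl) (hO2 2 3 rfl) (hO3 2 3 rfl)
    (by rw [orient3_cyclic]; exact s2) (by rw [orient3_cyclic, orient3_cyclic]; exact s4)
  have O5 := odd_vertex (v := X 5) (a := X 0) (w := Y 5) (w' := Y 4) (b := X 4) (c := X 3)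
    (d := X 1) (hX 5) (hX 0) (hY 5) (hY 4) (hX 4) (hX 3) (hX 1) (hXX 5 0 rfl) (hXY 5)
    (hXY' 4 5 rfl) (hXX' 4 5 rfl)
    (by rw [real_inner_comm]; exact yneg yL4) (by rw [real_inner_comm]; exact ym4)
    (yneg yL0) ym0 (by rw [real_inner_comm]; exact yneg yL2)
    (by linarith [(hXX' 3 4 rfl).1]) (by linarith [(hXX' 0 1 rfl).1])
    (hT1 5 0 rfl) (hT2 4 5 rfl) (hT3 4 5 rfl) (hO1 5 0 rfl) (hO2 4 5 rfl) (hO3 4 5 rfl)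
    (by rw [orient3_cyclic]; exact s4) (by rw [orient3_cyclic, orient3_cyclic]; exact s0)
  -- the inner angles
  have I1 := iota_box (o := b4) (a := b0) (b := b2) (hX 1) (hX 5) (hX 3)
    (by rw [real_inner_comm]; exact hy4) (by rw [real_inner_comm]; exact hy0) hy2
    (by rw [real_inner_comm]; exact ym0) ym2
  have I3 := iota_box (o := b0) (a := b2) (b := b4) (hX 3) (hX 1) (hX 5)
    (by rw [real_inner_comm]; exact hy0) (by rw [real_inner_comm]; exact hy2) hy4
    (by rw [real_inner_comm]; exact ym2) ym4
  have I5 := iota_box (o := b2) (a := b4) (b := b0) (hX 5) (hX 3) (hX 1)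
    (by rw [real_inner_comm]; exact hy2) (by rw [real_inner_comm]; exact hy4) hy0
    (by rw [real_inner_comm]; exact ym4) ym0
  have tot := box_total b0 b2 b4
  -- bookkeeping
  rw [sphExcess_def] at hE0 hE2 hE4
  rw [Fin.sum_univ_six]
  simp only [Fin.isValue, Fin.reduceAdd]
  linarith [C0, C2, C4, O1, O3, O5, I1, I3, I5, hE0, hE2, hE4, tot]


/-- **The angle budget of one ring, mirrored pattern** (ring `B` of the antiprism): bonds
`Xᵢ Xᵢ₊₁`, `Xᵢ Yᵢ`, `Xᵢ Yᵢ₊₁`, and at each `Xᵢ` the turns `Xᵢ₋₁ → Yᵢ → Yᵢ₊₁ → Xᵢ₊₁`.  Reduced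
to `ring_budget` by reversing the indices. [folklore] -/
private theorem ring_budget' (X Y : Fin 6 → E3) (hX : ∀ i, ‖X i‖ = 1) (hY : ∀ i, ‖Y i‖ = 1)
    (hXX : ∀ i j, j = i + 1 → 2201 / 4802 ≤ ⟪X i, X j⟫ ∧ ⟪X i, X j⟫ ≤ 2801 / 5202)
    (hXY : ∀ i, 2201 / 4802 ≤ ⟪X i, Y i⟫ ∧ ⟪X i, Y i⟫ ≤ 2801 / 5202)
    (hXY' : ∀ i j, j = i + 1 → 2201 / 4802 ≤ ⟪X i, Y j⟫ ∧ ⟪X i, Y j⟫ ≤ 2801 / 5202)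
    (hfar : ∀ i j, j = i + 2 → ⟪X j, X i⟫ ≤ 1233 / 5202)
    (hT1 : ∀ i j, j = i + 1 →
      Real.arccos (81 / 200) ≤ angle (perpTo (X j) (X i)) (perpTo (X j) (Y j)) ∧
      angle (perpTo (X j) (X i)) (perpTo (X j) (Y j)) ≤ Real.arccos (1 / 4))
    (hT2 : ∀ i j, j = i + 1 →
      Real.arccos (81 / 200) ≤ angle (perpTo (X i) (Y i)) (perpTo (X i) (Y j)) ∧
      angle (perpTo (X i) (Y i)) (perpTo (X i) (Y j)) ≤ Real.arccos (1 / 4))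
    (hT3 : ∀ i j, j = i + 1 →
      Real.arccos (81 / 200) ≤ angle (perpTo (X i) (Y j)) (perpTo (X i) (X j)) ∧
      angle (perpTo (X i) (Y j)) (perpTo (X i) (X j)) ≤ Real.arccos (1 / 4))
    (hO1 : ∀ i j, j = i + 1 → 0 < orient3 (X j) (X i) (Y j))
    (hO2 : ∀ i j, j = i + 1 → 0 < orient3 (X i) (Y i) (Y j)) :
    ∑ i, (angle (perpTo (X (i + 1)) (X i)) (perpTo (X (i + 1)) (Y (i + 1))) +
      angle (perpTo (X i) (Y i)) (perpTo (X i) (Y (i + 1))) +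
      angle (perpTo (X i) (Y (i + 1))) (perpTo (X i) (X (i + 1)))) ≤ 9 * π - 3371 / 500 := by
  have e1 : ∀ i : Fin 6, 5 - i = 5 - (i + 1) + 1 := by decide
  have e2 : ∀ i : Fin 6, 5 - i = 5 - (i + 2) + 2 := by decide
  have key := ring_budget (fun j => X (5 - j)) (fun j => Y (5 - j)) (fun j => hX _) (fun j => hY _)
    (fun i j h => by subst h; rw [real_inner_comm]; exact hXX _ _ (e1 i))
    (fun i => hXY _)
    (fun i j h => by subst h; exact hXY' _ _ (e1 i))
    (fun i j h => by subst h; rw [real_inner_comm]; exact hfar _ _ (e2 i))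
    (fun i j h => by subst h; exact hT1 _ _ (e1 i))
    (fun i j h => by subst h; exact hT2 _ _ (e1 i))
    (fun i j h => by subst h; exact hT3 _ _ (e1 i))
    (fun i j h => by subst h; exact hO1 _ _ (e1 i))
    (fun i j h => by subst h; exact hO2 _ _ (e1 i))
  rw [Fin.sum_univ_six] at key ⊢
  simp only [Fin.isValue, Fin.reduceAdd, Fin.reduceSub] at key ⊢
  linarith

/-- **The band excess**: a bonded triangle of unit vectors (pairwise cosines in `[c₁, c₀]`)
has spherical excess at least `E₀ = 0.498` (Euler's formula and the corner principle: the
smallest triangle, all cosines `c₀`, has the smallest area). [folklore] -/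
private theorem band_excess {a b c : E3} (ha : ‖a‖ = 1) (hb : ‖b‖ = 1) (hc : ‖c‖ = 1)
    (hab : 2201 / 4802 ≤ ⟪a, b⟫ ∧ ⟪a, b⟫ ≤ 2801 / 5202)
    (hac : 2201 / 4802 ≤ ⟪a, c⟫ ∧ ⟪a, c⟫ ≤ 2801 / 5202)
    (hbc : 2201 / 4802 ≤ ⟪b, c⟫ ∧ ⟪b, c⟫ ≤ 2801 / 5202) (hor : orient3 a b c ≠ 0) :
    249 / 500 ≤ sphExcess a b c := by
  have hli := linearIndependent_of_orient3_ne_zero hor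
  refine le_sphExcess_of_one_sub_cos_le ha hb hc hli (by linarith [pi_gt_three]) ?_
  refine band_bracket.trans ?_
  have h0 : (62282910004 / 512576216027 : ℝ) = eulerF (2801 / 5202) (2801 / 5202) (2801 / 5202) := by
    norm_num [eulerF, eulerGram]
  rw [← h0]
  exact le_eulerF_of_corners₃ (by norm_num) (by norm_num) (by norm_num) hbc hac hab band_corners

/-- `perpTo` is odd in its second argument. [folklore] -/
theorem perpTo_neg_right (v x : E3) : perpTo v (-x) = -perpTo v x := by
  rw [show -x = (-1 : ℝ) • x by simp, perpTo_smul_right]; simp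

/-- `orient3` is odd. [folklore] -/
theorem orient3_neg_neg_neg (a b c : E3) : orient3 (-a) (-b) (-c) = -orient3 a b c := by
  rw [show -a = (-1 : ℝ) • a by simp, show -b = (-1 : ℝ) • b by simp,
    show -c = (-1 : ℝ) • c by simp, orient3_smul_left, orient3_smul_mid, orient3_smul_right]
  ring

/-- **No positively oriented labelled antiprism.**  Rings `A`, `B` of unit vectors with the
antiprism bonds (cosines in `[c₁, c₀]`), the ring diagonals `Aᵢ Aᵢ₊₂`, `Bᵢ Bᵢ₊₂` far, all
`36` corners of the band triangles in `[Tm, TM]`, and the band triangle `(A₀, A₁, B₀)` positively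
oriented, do not exist. [folklore] -/
theorem no_config (A B : Fin 6 → E3) (hA : ∀ i, ‖A i‖ = 1) (hB : ∀ i, ‖B i‖ = 1)
    (hAA : ∀ i j, j = i + 1 → 2201 / 4802 ≤ ⟪A i, A j⟫ ∧ ⟪A i, A j⟫ ≤ 2801 / 5202)
    (hBB : ∀ i j, j = i + 1 → 2201 / 4802 ≤ ⟪B i, B j⟫ ∧ ⟪B i, B j⟫ ≤ 2801 / 5202)
    (hAB : ∀ i, 2201 / 4802 ≤ ⟪A i, B i⟫ ∧ ⟪A i, B i⟫ ≤ 2801 / 5202)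
    (hAB' : ∀ i j, j = i + 1 → 2201 / 4802 ≤ ⟪A j, B i⟫ ∧ ⟪A j, B i⟫ ≤ 2801 / 5202)
    (hfA : ∀ i j, j = i + 2 → ⟪A j, A i⟫ ≤ 1233 / 5202)
    (hfB : ∀ i j, j = i + 2 → ⟪B j, B i⟫ ≤ 1233 / 5202)
    (hT1 : ∀ i j, j = i + 1 →
      Real.arccos (81 / 200) ≤ angle (perpTo (A i) (A j)) (perpTo (A i) (B i)) ∧
      angle (perpTo (A i) (A j)) (perpTo (A i) (B i)) ≤ Real.arccos (1 / 4))
    (hT2 : ∀ i j, j = i + 1 →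
      Real.arccos (81 / 200) ≤ angle (perpTo (A j) (B j)) (perpTo (A j) (B i)) ∧
      angle (perpTo (A j) (B j)) (perpTo (A j) (B i)) ≤ Real.arccos (1 / 4))
    (hT3 : ∀ i j, j = i + 1 →
      Real.arccos (81 / 200) ≤ angle (perpTo (A j) (B i)) (perpTo (A j) (A i)) ∧
      angle (perpTo (A j) (B i)) (perpTo (A j) (A i)) ≤ Real.arccos (1 / 4))
    (hU1 : ∀ i j, j = i + 1 →
      Real.arccos (81 / 200) ≤ angle (perpTo (B j) (B i)) (perpTo (B j) (A j)) ∧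
      angle (perpTo (B j) (B i)) (perpTo (B j) (A j)) ≤ Real.arccos (1 / 4))
    (hU2 : ∀ i j, j = i + 1 →
      Real.arccos (81 / 200) ≤ angle (perpTo (B i) (A i)) (perpTo (B i) (A j)) ∧
      angle (perpTo (B i) (A i)) (perpTo (B i) (A j)) ≤ Real.arccos (1 / 4))
    (hU3 : ∀ i j, j = i + 1 →
      Real.arccos (81 / 200) ≤ angle (perpTo (B i) (A j)) (perpTo (B i) (B j)) ∧
      angle (perpTo (B i) (A j)) (perpTo (B i) (B j)) ≤ Real.arccos (1 / 4))
    (hD0 : 0 < orient3 (A 0) (A 1) (B 0)) : False := by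
  obtain ⟨hTm, hTM, -⟩ := T_bounds
  obtain ⟨hTM', hTm'⟩ := T_brackets
  have hAA' : ∀ i j, j = i + 1 → 2201 / 4802 ≤ ⟪A j, A i⟫ ∧ ⟪A j, A i⟫ ≤ 2801 / 5202 :=
    fun i j h => by rw [real_inner_comm]; exact hAA i j h
  have pne : ∀ {v x : E3}, ‖v‖ = 1 → ‖x‖ = 1 →
      2201 / 4802 ≤ ⟪v, x⟫ ∧ ⟪v, x⟫ ≤ 2801 / 5202 → perpTo v x ≠ 0 :=
    fun hv hx h => perpTo_ne_zero_of_unit hv hx (sq_lt_one_of_window h)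
  -- the orientation chain along ring `A` (vertex `A j`, `j = i + 1`, `i = k + 1`):
  -- `D j > 0` gives `D' i > 0` and `D i > 0`
  have step : ∀ k i j : Fin 6, i = k + 1 → j = i + 1 → 0 < orient3 (A j) (A (j + 1)) (B j) →
      0 < orient3 (A j) (B j) (B i) ∧ 0 < orient3 (A i) (A j) (B i) := by
    intro k i j hi hj hs
    have hθ := closing_angle_gt (hA j) (hA (j + 1)) (hA i) (hAA j (j + 1) rfl) (hAA' i j hj)
      (hfA i (j + 1) (by rw [hj, hi]; clear hj hi hs; revert k; decide))
    obtain ⟨⟨ε, hε, e1, e2, e3, -⟩, -⟩ := vertex4 (hA j) (pne (hA j) (hA (j + 1)) (hAA j _ rfl))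
      (pne (hA j) (hB j) (hAB j)) (pne (hA j) (hB i) (hAB' i j hj))
      (pne (hA j) (hA i) (hAA' i j hj)) hTm hTM (hT1 j (j + 1) rfl) (hT2 i j hj) (hT3 i j hj)
      (by linarith)
    rcases hε with rfl | rfl
    · refine ⟨by linarith, ?_⟩
      rw [orient3_cyclic, orient3_cyclic] at e3; linarith
    · exfalso; linarith
  obtain ⟨d5', d5⟩ := step 4 5 0 rfl rfl hD0
  obtain ⟨d4', d4⟩ := step 3 4 5 rfl rfl d5
  obtain ⟨d3', d3⟩ := step 2 3 4 rfl rfl d4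
  obtain ⟨d2', d2⟩ := step 1 2 3 rfl rfl d3
  obtain ⟨d1', d1⟩ := step 0 1 2 rfl rfl d2
  obtain ⟨d0', d0⟩ := step 5 0 1 rfl rfl d1
  have hD : ∀ i j, j = i + 1 → 0 < orient3 (A i) (A j) (B i) := by
    intro i j h; fin_cases i <;> subst h <;> assumption
  have hD' : ∀ i j, j = i + 1 → 0 < orient3 (A j) (B j) (B i) := by
    intro i j h; fin_cases i <;> subst h <;> assumption
  -- the two ring budgets
  have RA := ring_budget A B hA hB hAA hAB hAB' hfA hT1 hT2 hT3 hD hD'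
  have RB := ring_budget' B A hB hA hBB (fun i => by rw [real_inner_comm]; exact hAB i)
    (fun i j h => by rw [real_inner_comm]; exact hAB' i j h) hfB hU1 hU2 hU3
    (fun i j h => by rw [orient3_cyclic, orient3_cyclic]; exact hD' i j h)
    (fun i j h => by rw [orient3_cyclic]; exact hD i j h)
  -- the twelve band excesses
  have EX : ∀ i j, j = i + 1 → 249 / 500 ≤ sphExcess (A i) (A j) (B i) ∧
      249 / 500 ≤ sphExcess (B i) (A j) (B j) := by
    intro i j h
    refine ⟨band_excess (hA i) (hA j) (hB i) (hAA i j h) (hAB i) (hAB' i j h) (hD i j h).ne',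
      band_excess (hB i) (hA j) (hB j) ?_ (hBB i j h) ?_ ?_⟩
    · rw [real_inner_comm]; exact hAB' i j h
    · exact hAB j
    · rw [orient3_cyclic]; exact (hD' i j h).ne'
  have X0 := EX 0 1 rfl
  have X1 := EX 1 2 rfl
  have X2 := EX 2 3 rfl
  have X3 := EX 3 4 rfl
  have X4 := EX 4 5 rfl
  have X5 := EX 5 0 rfl
  simp only [sphExcess_def] at X0 X1 X2 X3 X4 X5
  rw [Fin.sum_univ_six] at RA RB
  simp only [Fin.isValue, Fin.reduceAdd] at RA RB
  have hπ := Real.pi_lt_d2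
  -- corner orientation conventions
  have ac : ∀ i j : Fin 6, angle (perpTo (A j) (A i)) (perpTo (A j) (B i)) =
      angle (perpTo (A j) (B i)) (perpTo (A j) (A i)) := fun i j => angle_comm _ _
  have bc : ∀ i j : Fin 6, angle (perpTo (A j) (B i)) (perpTo (A j) (B j)) =
      angle (perpTo (A j) (B j)) (perpTo (A j) (B i)) := fun i j => angle_comm _ _
  rw [ac, bc] at X0 X1 X2 X3 X4 X5
  linarith [X0.1, X0.2, X1.1, X1.2, X2.1, X2.2, X3.1, X3.2, X4.1, X4.2, X5.1, X5.2]


end AntiprismShell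

end Literature.Geometry.DiscreteGeometry
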